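import Literature.NumberTheory.LFunctions.DedekindZetaMellin
import Mathlib.MeasureTheory.Group.FundamentalDomain
import Mathlib.MeasureTheory.Function.JacobianOneDim
import Mathlib.MeasureTheory.Integral.Pi
import Mathlib.Analysis.SpecialFunctions.Gaussian.GaussianIntegral
import Mathlib.NumberTheory.NumberField.ClassNumber
import Mathlib.Analysis.Complex.LocallyUniformLimit
import Literature.NumberTheory.LFunctions.DedekindZetaProofs
import HarnessLib

/-!
# The Mellin unfolding of the theta integral (Hecke's continuation of `ζ_K`, III)

Sibling proofs file of `DedekindZetaMellin.lean` (Neukirch, *Algebraic Number Theory*, Ch. VII §5):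
the unfolding of `L(f - 1, s)` ((5.5)) and, eventually, the discharge of
`Literature.NumberTheory.LFunctions.exists_isDedekindZetaContinuation` ((5.11) (i)) from the theta transformation formula.
This first part: the theta series minus its constant term as a sum over `𝔞 ∖ 0`, re-indexed by
cone points and exponent vectors (`coneDecompEquiv`), with the unit action moved onto Hecke's
coordinates — the combinatorial half of the proof of (5.5).

## References

* J. Neukirch, *Algebraic Number Theory*, Springer 1999, Ch. VII (5.3)–(5.5). [NeukirchANT1999]
-/

noncomputable section

open scoped NumberField nonZeroDivisors ENNReal
open NumberField NumberField.InfinitePlace NumberField.Units MeasureTheory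

namespace Literature.NumberTheory.LFunctions.NumberField

variable {K : Type*} [Field K] [NumberField K]

/-- The theta summand at `ε_m a` in Hecke's coordinates is the summand at `a` in the translated
coordinates `c + m` (the identity `⟨aε x t', aε⟩ = ⟨a |ε|² x t', a⟩` of the proof of Neukirch
VII (5.5)). [folklore] -/
theorem thetaSummand_fundUnit_mul (m : Fin (rank K) → ℤ) (a : K) (c : Fin (rank K) → ℝ) (t : ℝ) :
    thetaSummand K (heckeCoord K c t) ((fundUnit K m : K) * a) =
      thetaSummand K (heckeCoord K (c + fun i ↦ (m i : ℝ)) t) a := by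
  simp only [thetaSummand, minkowskiQuadForm]
  rw [fundUnit, sum_heckeCoord_unit_mul c m t a]

/-- Summability of the theta summands over the nonzero elements of `𝔞` (from (3.5)). [folklore] -/
theorem summable_thetaSummand_ne_zero (I : FractionalIdeal (𝓞 K)⁰ K) {y : InfinitePlace K → ℝ}
    (hy : ∀ w, 0 < y w) :
    Summable fun a : {a : K // a ∈ I ∧ a ≠ 0} ↦ thetaSummand K y (a : K) := by
  have h := (summable_thetaIdeal_holds K I y hy).subtype {a : I | (a : K) ≠ 0}
  let e : ({a : I | (a : K) ≠ 0} : Set I) ≃ {a : K // a ∈ I ∧ a ≠ 0} :=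
    Equiv.subtypeSubtypeEquivSubtypeInter (fun a : K ↦ a ∈ I) (fun a ↦ a ≠ 0)
  exact (e.summable_iff (f := fun a : {a : K // a ∈ I ∧ a ≠ 0} ↦ thetaSummand K y (a : K))).mp
    (h.congr fun _ ↦ rfl)

/-- **`θ_𝔞(iy) - 1` is the sum over `𝔞 ∖ 0`** (the term `a = 0` is `1`). [folklore] -/
theorem thetaIdeal_sub_one_eq_tsum (I : FractionalIdeal (𝓞 K)⁰ K) {y : InfinitePlace K → ℝ}
    (hy : ∀ w, 0 < y w) :
    thetaIdeal K I y - 1 = ∑' a : {a : K // a ∈ I ∧ a ≠ 0}, thetaSummand K y (a : K) := by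
  classical
  have hs := summable_thetaIdeal_holds K I y hy
  rw [thetaIdeal, hs.tsum_eq_add_tsum_ite ⟨0, FractionalIdeal.zero_mem I⟩]
  have h0 : ((⟨0, FractionalIdeal.zero_mem I⟩ : I) : K) = 0 := rfl
  rw [h0, thetaSummand_zero, add_sub_cancel_left]
  have hsupp : Function.support (fun a : I ↦
      if a = ⟨0, FractionalIdeal.zero_mem I⟩ then 0 else thetaSummand K y (a : K)) ⊆
      {a : I | (a : K) ≠ 0} := by
    intro a ha h
    apply ha
    have ha0 : a = ⟨0, FractionalIdeal.zero_mem I⟩ := Subtype.ext h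
    show (if a = ⟨0, FractionalIdeal.zero_mem I⟩ then 0 else thetaSummand K y (a : K)) = 0
    rw [if_pos ha0]
  rw [← tsum_subtype_eq_of_support_subset hsupp]
  let e : ({a : I | (a : K) ≠ 0} : Set I) ≃ {a : K // a ∈ I ∧ a ≠ 0} :=
    Equiv.subtypeSubtypeEquivSubtypeInter (fun a : K ↦ a ∈ I) (fun a ↦ a ≠ 0)
  rw [← e.symm.tsum_eq]
  refine tsum_congr fun b ↦ ?_
  have hb : ((e.symm b : ({a : I | (a : K) ≠ 0} : Set I)) : I) ≠ ⟨0, FractionalIdeal.zero_mem I⟩ :=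
    fun h ↦ b.2.2 (congr_arg (fun x : I ↦ (x : K)) h)
  rw [if_neg hb]
  rfl

/-- **`θ_𝔞(i y(c,t)) - 1` as a sum over cone points and exponent vectors**, with the unit moved
onto the coordinates: `∑_{a'} ∑_{m ∈ ℤ^{r-1}} e^{-π⟨a' y(c+m,t), a'⟩}` (Neukirch VII, proof of (5.5):
"`aε` runs through `𝔞^*` exactly once"). [folklore] -/
theorem thetaIdeal_heckeCoord_sub_one_eq_tsum (I : FractionalIdeal (𝓞 K)⁰ K)
    (c : Fin (rank K) → ℝ) (t : ℝ) :
    thetaIdeal K I (heckeCoord K c t) - 1 =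
      ∑' p : conePoints K I × (Fin (rank K) → ℤ),
        thetaSummand K (heckeCoord K (c + fun i ↦ (p.2 i : ℝ)) t) (p.1 : K) := by
  rw [thetaIdeal_sub_one_eq_tsum I (heckeCoord_pos c t), ← (coneDecompEquiv K I).symm.tsum_eq]
  refine tsum_congr fun p ↦ ?_
  rw [coneDecompEquiv_symm_apply, thetaSummand_fundUnit_mul]

/-- Summability of the re-indexed family (transport of `summable_thetaSummand_ne_zero`). [folklore] -/
theorem summable_thetaSummand_coneDecomp (I : FractionalIdeal (𝓞 K)⁰ K)
    (c : Fin (rank K) → ℝ) (t : ℝ) :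
    Summable fun p : conePoints K I × (Fin (rank K) → ℤ) ↦
      thetaSummand K (heckeCoord K (c + fun i ↦ (p.2 i : ℝ)) t) (p.1 : K) := by
  have h := (summable_thetaSummand_ne_zero I (heckeCoord_pos c t))
  rw [← (coneDecompEquiv K I).symm.summable_iff] at h
  refine h.congr fun p ↦ ?_
  simp only [Function.comp_apply, coneDecompEquiv_symm_apply, thetaSummand_fundUnit_mul]

/-! ### Tiling `ℝ^{r-1}` by integer translates of the unit cube

The unfolding `∑_{ε} ∫_F = ∫_S` of the proof of Neukirch VII (5.5), in Hecke's coordinates: the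
unit cube `[0,1]^{r-1}` is a fundamental domain for `ℤ^{r-1}` acting on `ℝ^{r-1}` by translation
(Mathlib: `ZSpan.isAddFundamentalDomain'` and `ZSpan.fundamentalDomain_pi_basisFun` for the standard
basis, `IsAddFundamentalDomain.lintegral_eq_tsum''`). -/

section Tiling

open Submodule

variable {ι : Type*} [Fintype ι]

/-- The lattice vector with integer coordinates `m`. [folklore] -/
theorem coe_restrictScalars_basisFun_equivFun_symm [DecidableEq ι] (m : ι → ℤ) :
    ((((Pi.basisFun ℝ ι).restrictScalars ℤ).equivFun.symm m : span ℤ (Set.range (Pi.basisFun ℝ ι)))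
      : ι → ℝ) = fun i ↦ (m i : ℝ) := by
  rw [Module.Basis.equivFun_symm_apply]
  simp only [AddSubmonoidClass.coe_finsetSum, SetLike.val_smul, Module.Basis.restrictScalars_apply,
    zsmul_eq_mul]
  funext i
  rw [Finset.sum_apply]
  simp only [Pi.mul_apply, Pi.intCast_apply, Pi.basisFun_apply, Pi.single_apply, mul_ite, mul_one,
    mul_zero, Finset.sum_ite_eq, Finset.mem_univ, if_true]

/-- **Tiling**: `∫_{ℝ^ι} G = ∑_{m ∈ ℤ^ι} ∫_{[0,1]^ι} G(x + m) dx` for every `G ≥ 0`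
(Lebesgue integral, `ℝ≥0∞`-valued). [folklore] -/
theorem lintegral_eq_tsum_lintegral_unitCube_add_intCast (G : (ι → ℝ) → ENNReal) :
    ∫⁻ x, G x = ∑' m : ι → ℤ, ∫⁻ x in Set.Icc (0 : ι → ℝ) 1, G (x + fun i ↦ (m i : ℝ)) := by
  classical
  haveI : Countable (span ℤ (Set.range (Pi.basisFun ℝ ι))).toAddSubgroup :=
    Finsupp.instCountableSubtypeMemSubmoduleSpanRange _
  have hae : (Set.pi Set.univ fun _ ↦ Set.Ico (0 : ℝ) 1) =ᵐ[volume] Set.Icc (0 : ι → ℝ) 1 :=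
    Measure.univ_pi_Ico_ae_eq_Icc (μ := fun _ : ι ↦ (volume : Measure ℝ)) (f := 0) (g := 1)
  rw [(ZSpan.isAddFundamentalDomain' (Pi.basisFun ℝ ι) volume).lintegral_eq_tsum'' G,
    ZSpan.fundamentalDomain_pi_basisFun]
  simp_rw [Measure.restrict_congr_set hae]
  let e : (ι → ℤ) ≃ (span ℤ (Set.range (Pi.basisFun ℝ ι))).toAddSubgroup :=
    ((Pi.basisFun ℝ ι).restrictScalars ℤ).equivFun.toEquiv.symm
  rw [← e.tsum_eq]
  refine tsum_congr fun m ↦ lintegral_congr fun x ↦ ?_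
  show G (((((Pi.basisFun ℝ ι).restrictScalars ℤ).equivFun.symm m :
    span ℤ (Set.range (Pi.basisFun ℝ ι))) : ι → ℝ) + x) = _
  rw [coe_restrictScalars_basisFun_equivFun_symm m, add_comm]

end Tiling

/-! ### The cube integral of `θ - 1` unfolded over cone points (Neukirch VII (5.5), first half) -/

/-- Measurability of the theta summand in Hecke's coordinates (as a function of `c`). [folklore] -/
theorem measurable_thetaSummand_heckeCoord (a : K) (t : ℝ) :
    Measurable fun c : Fin (rank K) → ℝ ↦ thetaSummand K (heckeCoord K c t) a :=
  ((continuous_thetaSummand a).comp (by simpa using continuous_heckeCoord_smul (K := K) 1 t)).measurable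

/-- A fractional ideal of a number field is countable (a finite free `ℤ`-module). [folklore] -/
theorem countable_fractionalIdeal (I : FractionalIdeal (𝓞 K)⁰ K) : Countable I :=
  Countable.of_equiv _ (Module.Free.chooseBasis ℤ I).equivFun.toEquiv.symm

/-- The cone points of a fractional ideal form a countable set. [folklore] -/
theorem countable_conePoints (I : FractionalIdeal (𝓞 K)⁰ K) : Countable (conePoints K I) := by
  haveI := countable_fractionalIdeal I
  exact (Function.Injective.countable (f := fun a : conePoints K I ↦ (⟨a.1, a.2.1⟩ : I))
    fun a b hab ↦ Subtype.ext (congr_arg (fun x : I ↦ (x : K)) hab))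

/-- **Unfolding over the units**: for every `t`,
`∫_{[0,1]^{r-1}} (θ_𝔞(i y(c,t)) - 1) dc = ∑_{a' cone point} ∫_{ℝ^{r-1}} e^{-π⟨a' y(c,t), a'⟩} dc`
(`ℝ≥0∞`-valued Lebesgue integrals): the sum over `𝔞 ∖ 0` is re-indexed by `coneDecompEquiv`, the unit
`ε_m` is moved onto the coordinates (`thetaSummand_fundUnit_mul`), and the translates of the unit
cube tile `ℝ^{r-1}` — Neukirch VII, proof of (5.5), `∫_S ∑_{a ∈ ℜ} = w⁻¹ ∫_F (θ - 1)`. [folklore] -/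
theorem lintegral_unitCube_thetaIdeal_sub_one (I : FractionalIdeal (𝓞 K)⁰ K) (t : ℝ) :
    ∫⁻ c in Set.Icc (0 : Fin (rank K) → ℝ) 1, ENNReal.ofReal (thetaIdeal K I (heckeCoord K c t) - 1) =
      ∑' a : conePoints K I, ∫⁻ c : Fin (rank K) → ℝ,
        ENNReal.ofReal (thetaSummand K (heckeCoord K c t) (a : K)) := by
  haveI := countable_conePoints I
  -- `θ - 1` as an `ℝ≥0∞`-valued sum over cone points and exponent vectors
  have h1 : ∀ c : Fin (rank K) → ℝ, ENNReal.ofReal (thetaIdeal K I (heckeCoord K c t) - 1) =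
      ∑' p : conePoints K I × (Fin (rank K) → ℤ),
        ENNReal.ofReal (thetaSummand K (heckeCoord K (c + fun i ↦ (p.2 i : ℝ)) t) (p.1 : K)) := by
    intro c
    rw [thetaIdeal_heckeCoord_sub_one_eq_tsum I c t, ENNReal.ofReal_tsum_of_nonneg
      (fun _ ↦ (thetaSummand_pos _ _).le) (summable_thetaSummand_coneDecomp I c t)]
  have hmeas : ∀ p : conePoints K I × (Fin (rank K) → ℤ), AEMeasurable (fun c : Fin (rank K) → ℝ ↦
      ENNReal.ofReal (thetaSummand K (heckeCoord K (c + fun i ↦ (p.2 i : ℝ)) t) (p.1 : K)))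
      (volume.restrict (Set.Icc (0 : Fin (rank K) → ℝ) 1)) := fun p ↦
    ((measurable_thetaSummand_heckeCoord (K := K) (p.1 : K) t).comp
      (measurable_id.add_const _)).ennreal_ofReal.aemeasurable
  simp_rw [h1]
  rw [lintegral_tsum hmeas, ENNReal.tsum_prod']
  refine tsum_congr fun a ↦ ?_
  rw [lintegral_eq_tsum_lintegral_unitCube_add_intCast]

/-! ## The Mellin–Gamma identity in Hecke's coordinates (Neukirch VII (5.5), analytic half)

For a single `a ≠ 0` and real `σ > 0` we evaluate
`∫_{t>0} t^{σ-1} ∫_{ℝ^{r-1}} e^{-π⟨a y(c,t), a⟩} dc dt` as a product of Gamma functions, through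
(A) the scaling `c = c'/2`, (B) the substitution `t = e^{nτ}`, (C) the measure-preserving splitting
`ℝ^{r-1} × ℝ ≅ ℝ^{places}` along `w₀`, (D) the change of variables `y = expMapBasis x` (Roblot's
Jacobian `abs_det_fderiv_expMapBasis`), and (E) Fubini over the places with the one-variable
Gamma integrals. Combined with `lintegral_unitCube_thetaIdeal_sub_one` this is Neukirch's
`|d_K|^s π^{-ns} Γ_K(s) 𝔑(𝔞)^{2s}/|N(a)|^{2s} = ∫ e^{-π⟨ay/d_𝔞^{1/n}, a⟩} N(y)^s dy/y` summed over the
cone representatives (VII §5, before (5.5)), in our normalisation. -/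

open NumberField.mixedEmbedding NumberField.mixedEmbedding.fundamentalCone
  NumberField.Units.dirichletUnitTheorem


/-- **(B)** The substitution `t = e^{nτ}` in a Mellin-type integral:
`∫_{t>0} t^{σ-1} F((log t)/n) dt = ∫_τ n e^{nστ} F(τ) dτ` (`ℝ≥0∞`-valued). [folklore] -/
theorem lintegral_Ioi_rpow_mul_comp_log_div {n : ℝ} (hn : 0 < n) (σ : ℝ) (F : ℝ → ℝ≥0∞) :
    ∫⁻ t in Set.Ioi 0, ENNReal.ofReal (t ^ (σ - 1)) * F (Real.log t / n) =
      ∫⁻ τ, ENNReal.ofReal (n * Real.exp (n * σ * τ)) * F τ := by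
  have himage : (fun τ : ℝ ↦ Real.exp (n * τ)) '' Set.univ = Set.Ioi 0 := by
    ext t
    simp only [Set.image_univ, Set.mem_range, Set.mem_Ioi]
    constructor
    · rintro ⟨τ, rfl⟩; exact Real.exp_pos _
    · intro ht; exact ⟨Real.log t / n, by rw [mul_div_cancel₀ _ hn.ne', Real.exp_log ht]⟩
  have hderiv : ∀ τ ∈ Set.univ, HasDerivWithinAt (fun τ : ℝ ↦ Real.exp (n * τ))
      (n * Real.exp (n * τ)) Set.univ τ := fun τ _ ↦ by
    have := ((hasDerivAt_id τ).const_mul n).exp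
    simp only [mul_one] at this
    rw [mul_comm] 
    exact (by simpa [mul_comm] using this : HasDerivAt (fun τ ↦ Real.exp (n * τ)) (Real.exp (n * τ) * n) τ).hasDerivWithinAt |>.congr_deriv (by ring)
  have hinj : Set.InjOn (fun τ : ℝ ↦ Real.exp (n * τ)) Set.univ := fun a _ b _ h ↦ by
    have := Real.exp_injective h
    exact mul_left_cancel₀ hn.ne' this
  rw [← himage, lintegral_image_eq_lintegral_abs_deriv_mul MeasurableSet.univ hderiv hinj,
    Measure.restrict_univ]
  refine lintegral_congr fun τ ↦ ?_
  have hpos : 0 < Real.exp (n * τ) := Real.exp_pos _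
  rw [Real.log_exp, mul_div_cancel_left₀ _ hn.ne', ← mul_assoc, ← ENNReal.ofReal_mul (abs_nonneg _),
    abs_of_pos (mul_pos hn hpos), Real.rpow_def_of_pos hpos, Real.log_exp]
  congr 2
  rw [mul_assoc, ← Real.exp_add]
  congr 1
  ring

/-- **(A)** Scaling in `ℝ^ι`: `∫ G(2c) dc = 2^{-|ι|} ∫ G(c) dc` (Lebesgue measure, `ℝ≥0∞`-valued;
Mathlib `Measure.map_addHaar_smul`). [folklore] -/
theorem lintegral_comp_two_smul {ι : Type*} [Fintype ι] (G : (ι → ℝ) → ℝ≥0∞) :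
    ∫⁻ c : ι → ℝ, G ((2 : ℝ) • c) = ENNReal.ofReal ((2 ^ Fintype.card ι)⁻¹) * ∫⁻ c, G c := by
  have h2 : (2 : ℝ) ≠ 0 := two_ne_zero
  let e : (ι → ℝ) ≃ᵐ (ι → ℝ) := (Homeomorph.smul (isUnit_iff_ne_zero.2 h2).unit).toMeasurableEquiv
  have he : ∀ c, e c = (2 : ℝ) • c := fun _ ↦ rfl
  calc ∫⁻ c : ι → ℝ, G ((2 : ℝ) • c) = ∫⁻ c, G (e c) := by simp_rw [he]
    _ = ∫⁻ c, G c ∂(Measure.map e volume) := (lintegral_map_equiv G e).symm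
    _ = ∫⁻ c, G c ∂(Measure.map (fun c : ι → ℝ ↦ (2 : ℝ) • c) volume) := rfl
    _ = ENNReal.ofReal ((2 ^ Fintype.card ι)⁻¹) * ∫⁻ c, G c := by
        rw [Measure.map_addHaar_smul volume h2, lintegral_smul_measure, Module.finrank_fintype_fun_eq_card,
          abs_of_pos (by positivity)]
        rfl

/-! ### (C) Splitting `ℝ^{places} ≅ ℝ^{r-1} × ℝ` along `w₀` -/

open scoped Classical in
open NumberField.mixedEmbedding NumberField.Units.dirichletUnitTheorem
  NumberField.mixedEmbedding.fundamentalCone in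
/-- The measurable equivalence `(c, τ) ↦ x`, `x_{w₀} = τ`, `x_w = c_{i(w)}` (`i = equivFinRank⁻¹`) for
`w ≠ w₀`, between `ℝ^{r-1} × ℝ` and `ℝ^{places}`; explicit so that its values are definitional.
[folklore] -/
theorem exists_measurableEquiv_realSpace_split :
    ∃ e : (Fin (rank K) → ℝ) × ℝ ≃ᵐ realSpace K, MeasurePreserving e volume volume ∧
      ∀ p, (e p : realSpace K) = fun w ↦
        if hw : w = w₀ then p.2 else p.1 (equivFinRank.symm ⟨w, hw⟩) := by
  let toF : (Fin (rank K) → ℝ) × ℝ → realSpace K := fun p w ↦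
    if hw : w = w₀ then p.2 else p.1 (equivFinRank.symm ⟨w, hw⟩)
  let invF : realSpace K → (Fin (rank K) → ℝ) × ℝ := fun x ↦
    (fun i ↦ x (equivFinRank i), x w₀)
  have hleft : Function.LeftInverse invF toF := by
    rintro ⟨c, τ⟩
    simp only [toF, invF, dif_pos, Prod.mk.injEq]
    refine ⟨funext fun i ↦ ?_, trivial⟩
    rw [dif_neg (equivFinRank i).2]
    simp
  have hright : Function.RightInverse invF toF := by
    intro x
    funext w
    simp only [toF, invF]
    split_ifs with hw
    · rw [hw]
    · simp
  have hmeas_to : Measurable toF := by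
    refine measurable_pi_lambda _ fun w ↦ ?_
    by_cases hw : w = w₀
    · simp only [toF, dif_pos hw]; exact measurable_snd
    · simp only [toF, dif_neg hw]; exact (measurable_pi_apply _).comp measurable_fst
  have hmeas_inv : Measurable invF :=
    (measurable_pi_lambda _ fun i ↦ measurable_pi_apply _).prodMk (measurable_pi_apply _)
  let e : (Fin (rank K) → ℝ) × ℝ ≃ᵐ realSpace K :=
    { toFun := toF, invFun := invF, left_inv := hleft, right_inv := hright,
      measurable_toFun := hmeas_to, measurable_invFun := hmeas_inv }
  refine ⟨e, ⟨hmeas_to, ?_⟩, fun p ↦ rfl⟩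
  -- the image measure is Lebesgue: check on boxes
  symm
  refine Measure.pi_eq fun s hs ↦ ?_
  change (Measure.map toF volume) (Set.univ.pi s) = _
  rw [Measure.map_apply hmeas_to (MeasurableSet.univ_pi hs)]
  have hpre : toF ⁻¹' Set.univ.pi s =
      (Set.univ.pi fun i ↦ s (equivFinRank i : InfinitePlace K)) ×ˢ s w₀ := by
    ext ⟨c, τ⟩
    simp only [Set.mem_preimage, Set.mem_pi, Set.mem_univ, forall_true_left, Set.mem_prod, toF]
    constructor
    · intro h
      refine ⟨fun i ↦ ?_, by simpa using h w₀⟩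
      have := h (equivFinRank i)
      rwa [dif_neg (equivFinRank i).2, Subtype.coe_eta, Equiv.symm_apply_apply] at this
    · rintro ⟨h1, h2⟩ w
      by_cases hw : w = w₀
      · subst hw; simpa using h2
      · rw [dif_neg hw]
        have := h1 (equivFinRank.symm ⟨w, hw⟩)
        simpa using this
  rw [hpre, Measure.volume_eq_prod, Measure.prod_prod, volume_pi, Measure.pi_pi]
  -- reorganise the product over the places as `w₀` and the others
  rw [← Finset.prod_erase_mul _ _ (Finset.mem_univ w₀)]
  congr 1
  refine (Finset.prod_bij' (fun i _ ↦ (equivFinRank i : InfinitePlace K))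
    (fun w hw ↦ equivFinRank.symm ⟨w, Finset.ne_of_mem_erase hw⟩) ?_ ?_ ?_ ?_ ?_)
  · intro i _; exact Finset.mem_erase.mpr ⟨(equivFinRank i).2, Finset.mem_univ _⟩
  · intro w hw; exact Finset.mem_univ _
  · intro i _; simp
  · intro w hw; simp
  · intro i _; rfl


open scoped Classical in
/-- `expMapBasis` maps `ℝ^{places}` onto the open orthant `(0,∞)^{places}` (its target as an open partial
homeomorphism, Mathlib `expMap_target`). [folklore] -/
theorem image_expMapBasis_univ :
    (expMapBasis (K := K)) '' Set.univ = Set.univ.pi fun _ ↦ Set.Ioi 0 := by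
  rw [← expMapBasis_source (K := K), OpenPartialHomeomorph.image_source_eq_target, expMapBasis,
    Homeomorph.transOpenPartialHomeomorph_target, expMap_target]

open scoped Classical in
/-- `∏_{w complex} y_w = ∏_w y_w^{e_w - 1}` (`e_w - 1 = 0` at real and `1` at complex places). [folklore] -/
theorem prod_isComplex_eq_prod_pow_mult_sub_one (y : InfinitePlace K → ℝ) :
    ∏ w : {w : InfinitePlace K // IsComplex w}, y w.1 = ∏ w, y w ^ (mult w - 1) := by
  rw [prod_eq_prod_mul_prod (fun w ↦ y w ^ (mult w - 1))]
  simp [mult_isReal, mult_isComplex]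


open scoped Classical in
/-- The Jacobian of `expMapBasis` against the Gamma integrand: pointwise identity
`|det D expMapBasis(x)| · ∏_w y_w^{e_wσ-1} e^{-b_w y_w} = (2^{-r₂} n R) · e^{nσ x_{w₀}} · e^{-∑_w b_w y_w}`
at `y = expMapBasis x` (`b_w = π e_w |a|_w²`; Mathlib `abs_det_fderiv_expMapBasis`, `prod_expMapBasis_pow`). [folklore] -/
theorem abs_det_mul_prod_gammaIntegrand (x : realSpace K) (a : K) (σ : ℝ) :
    |(fderiv_expMapBasis K x).det| *
        ∏ w, (expMapBasis x w) ^ ((mult w : ℝ) * σ - 1) *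
          Real.exp (-(Real.pi * mult w * (w a) ^ 2 * expMapBasis x w)) =
      (2⁻¹ ^ nrComplexPlaces K * Module.finrank ℚ K * regulator K) *
        (Real.exp (Module.finrank ℚ K * σ * x w₀) *
          thetaSummand K (expMapBasis x) a) := by
  set y := expMapBasis x with hy
  have hypos : ∀ w, 0 < y w := fun w ↦ expMapBasis_pos x w
  -- the theta summand as a product of exponentials
  have hθ : thetaSummand K y a = ∏ w, Real.exp (-(Real.pi * mult w * (w a) ^ 2 * y w)) := by
    rw [thetaSummand, minkowskiQuadForm, ← Real.exp_sum, Finset.mul_sum]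
    congr 1
    refine Finset.sum_congr rfl fun w _ ↦ by ring
  -- `e^{n x_{w₀}} = ∏ y^{e_w}` and `e^{nσ x_{w₀}} = ∏ y^{e_w σ}`
  have hN : Real.exp (x w₀ * Module.finrank ℚ K) = ∏ w, y w ^ mult w := by
    rw [Real.exp_mul, Real.rpow_natCast, ← prod_expMapBasis_pow]
  have hNσ : Real.exp (Module.finrank ℚ K * σ * x w₀) = ∏ w, y w ^ ((mult w : ℝ) * σ) := by
    have : Real.exp (Module.finrank ℚ K * σ * x w₀) = (Real.exp (x w₀ * Module.finrank ℚ K)) ^ σ := by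
      rw [← Real.exp_mul]; congr 1; ring
    rw [this, hN, ← Real.finsetProd_rpow _ _ fun w _ ↦ (pow_pos (hypos w) _).le]
    refine Finset.prod_congr rfl fun w _ ↦ ?_
    rw [← Real.rpow_natCast, ← Real.rpow_mul (hypos w).le]
  rw [abs_det_fderiv_expMapBasis, prod_isComplex_eq_prod_pow_mult_sub_one, hθ, hNσ, hN,
    Finset.prod_mul_distrib, ← hy]
  -- now a pure product identity
  have key : (∏ w, y w ^ mult w) * (∏ w, y w ^ (mult w - 1))⁻¹ *
      ∏ w, y w ^ ((mult w : ℝ) * σ - 1) = ∏ w, y w ^ ((mult w : ℝ) * σ) := by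
    rw [← Finset.prod_inv_distrib, ← Finset.prod_mul_distrib, ← Finset.prod_mul_distrib]
    refine Finset.prod_congr rfl fun w _ ↦ ?_
    have h0 := hypos w
    have hm : 1 ≤ mult w := mult_pos
    rw [← Real.rpow_natCast, ← Real.rpow_natCast, Nat.cast_sub hm, Nat.cast_one, ← Real.rpow_neg h0.le,
      ← Real.rpow_add h0, ← Real.rpow_add h0]
    congr 1; ring
  rw [← key]
  ring

open scoped Classical in
/-- **Change of variables `y = expMapBasis x`** for the Gaussian of a fixed `a` (the substitution
`y ↦ π|a|²y` and the passage to `F × ℝ_+^*` of Neukirch VII §5, here through Roblot's `expMapBasis`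
and its Jacobian, Mathlib `lintegral_image_eq_lintegral_abs_det_fderiv_mul`):
`∫_{(0,∞)^{places}} ∏_w y_w^{e_wσ-1} e^{-π e_w|a|_w² y_w} dy
  = 2^{-r₂} n R ∫_{ℝ^{places}} e^{nσ x_{w₀}} e^{-π⟨a·expMapBasis(x), a⟩} dx`. [folklore] -/
theorem setLIntegral_pi_Ioi_prod_gammaIntegrand_eq_lintegral_expMapBasis (a : K) (σ : ℝ) :
    ∫⁻ y in Set.univ.pi (fun _ : InfinitePlace K ↦ Set.Ioi (0 : ℝ)),
        ENNReal.ofReal (∏ w, (y w) ^ ((mult w : ℝ) * σ - 1) *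
          Real.exp (-(Real.pi * mult w * (w a) ^ 2 * y w))) =
      ENNReal.ofReal (2⁻¹ ^ nrComplexPlaces K * Module.finrank ℚ K * regulator K) *
        ∫⁻ x : realSpace K, ENNReal.ofReal (Real.exp (Module.finrank ℚ K * σ * x w₀) *
          thetaSummand K (expMapBasis x) a) := by
  rw [← image_expMapBasis_univ, lintegral_image_eq_lintegral_abs_det_fderiv_mul volume
    MeasurableSet.univ (fun x _ ↦ (hasFDerivAt_expMapBasis K x).hasFDerivWithinAt)
    (injective_expMapBasis K).injOn, Measure.restrict_univ,
    ← lintegral_const_mul' _ _ ENNReal.ofReal_ne_top]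
  refine lintegral_congr fun x ↦ ?_
  have hc : (0 : ℝ) ≤ 2⁻¹ ^ nrComplexPlaces K * Module.finrank ℚ K * regulator K :=
    mul_nonneg (mul_nonneg (pow_nonneg (by norm_num) _) (Nat.cast_nonneg _)) (regulator_pos K).le
  rw [← ENNReal.ofReal_mul (abs_nonneg _), ← ENNReal.ofReal_mul hc, abs_det_mul_prod_gammaIntegrand]

/-! ### The Gamma integrals over the positive orthant (Neukirch VII (4.2), §5: `Γ_K(s)`)

After the change of variables to `y ∈ R_+^* = (0,∞)^{places}` the integrand of the unfolded Mellin
transform is a product over the places of one-variable Gamma integrands; here we evaluate it: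
`∫_{(0,∞)^{places}} ∏_w y_w^{e_w σ - 1} e^{-π e_w |a|_w² y_w} dy = ∏_w (π e_w |a|_w²)^{-e_w σ} Γ(e_w σ)`,
which is Neukirch's substitution `y ↦ π|a|²y` in the Gamma integral (VII §5, before (5.5), and
(4.2) for the value of `Γ_K`). -/

/-- The one-variable Gamma integrand `u ↦ u^{eσ - 1} e^{-b u}` is integrable on `(0, ∞)` for
`e σ > 0`, `b > 0` (Mathlib `integrableOn_rpow_mul_exp_neg_mul_rpow` with `p = 1`). [folklore] -/
theorem integrableOn_gammaIntegrand {c b : ℝ} (hc : 0 < c) (hb : 0 < b) :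
    IntegrableOn (fun u : ℝ ↦ u ^ (c - 1) * Real.exp (-(b * u))) (Set.Ioi 0) := by
  have h := integrableOn_rpow_mul_exp_neg_mul_rpow (s := c - 1) (p := 1) (by linarith) le_rfl hb
  refine h.congr_fun (fun u _ ↦ ?_) measurableSet_Ioi
  simp only [Real.rpow_one, neg_mul]

/-- **Product of Gamma integrals over the positive orthant**: for `a ≠ 0` and `σ > 0`,
`∫_{(0,∞)^{places}} ∏_w y_w^{e_w σ - 1} e^{-π e_w |a|_w² y_w} dy = ∏_w (π e_w |a|_w²)^{-e_w σ} Γ(e_w σ)`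
(Fubini over the places, Mathlib `integral_fintype_prod_eq_prod`, and
`Real.integral_rpow_mul_exp_neg_mul_Ioi`). [cite: NeukirchANT1999, Ch. VII (4.2) and §5 before (5.5)] -/
theorem integral_pi_Ioi_prod_gammaIntegrand (a : K) (ha : a ≠ 0) {σ : ℝ} (hσ : 0 < σ) :
    ∫ y : InfinitePlace K → ℝ, ∏ w, (y w) ^ ((mult w : ℝ) * σ - 1) *
        Real.exp (-(Real.pi * mult w * (w a) ^ 2 * y w))
        ∂(Measure.pi fun _ ↦ (volume : Measure ℝ).restrict (Set.Ioi 0)) =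
      ∏ w : InfinitePlace K, (1 / (Real.pi * mult w * (w a) ^ 2)) ^ ((mult w : ℝ) * σ) *
        Real.Gamma ((mult w : ℝ) * σ) := by
  rw [integral_fintype_prod_eq_prod (𝕜 := ℝ)
    (f := fun (w : InfinitePlace K) (u : ℝ) ↦ u ^ ((mult w : ℝ) * σ - 1) *
      Real.exp (-(Real.pi * mult w * (w a) ^ 2 * u)))]
  refine Finset.prod_congr rfl fun w _ ↦ ?_
  have hb : 0 < Real.pi * mult w * (w a) ^ 2 := by
    have : 0 < w a := pos_iff.mpr ha
    have : (0 : ℝ) < mult w := Nat.cast_pos.mpr mult_pos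
    positivity
  exact Real.integral_rpow_mul_exp_neg_mul_Ioi (by have : (0:ℝ) < mult w := Nat.cast_pos.mpr mult_pos; positivity) hb

/-- The same, as an `ℝ≥0∞`-valued Lebesgue integral over the orthant `(0,∞)^{places} ⊂ ℝ^{places}`
(nonnegative integrand; `Measure.restrict_pi_pi`). [folklore] -/
theorem setLIntegral_pi_Ioi_prod_gammaIntegrand (a : K) (ha : a ≠ 0) {σ : ℝ} (hσ : 0 < σ) :
    ∫⁻ y in Set.pi Set.univ (fun _ : InfinitePlace K ↦ Set.Ioi (0 : ℝ)),
        ENNReal.ofReal (∏ w, (y w) ^ ((mult w : ℝ) * σ - 1) *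
          Real.exp (-(Real.pi * mult w * (w a) ^ 2 * y w))) =
      ENNReal.ofReal (∏ w : InfinitePlace K, (1 / (Real.pi * mult w * (w a) ^ 2)) ^ ((mult w : ℝ) * σ) *
        Real.Gamma ((mult w : ℝ) * σ)) := by
  have hmeas : volume.restrict (Set.pi Set.univ fun _ : InfinitePlace K ↦ Set.Ioi (0 : ℝ)) =
      Measure.pi fun _ ↦ (volume : Measure ℝ).restrict (Set.Ioi 0) :=
    Measure.restrict_pi_pi (fun _ : InfinitePlace K ↦ (volume : Measure ℝ)) fun _ ↦ Set.Ioi 0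
  rw [hmeas, ← integral_pi_Ioi_prod_gammaIntegrand a ha hσ, ofReal_integral_eq_lintegral_ofReal]
  · -- integrability: product of integrable one-variable Gamma integrands
    refine Integrable.fintype_prod (f := fun (w : InfinitePlace K) (u : ℝ) ↦
      u ^ ((mult w : ℝ) * σ - 1) * Real.exp (-(Real.pi * mult w * (w a) ^ 2 * u))) fun w ↦ ?_
    have hb : 0 < Real.pi * mult w * (w a) ^ 2 := by
      have : 0 < w a := pos_iff.mpr ha
      have : (0 : ℝ) < mult w := Nat.cast_pos.mpr mult_pos
      positivity
    exact integrableOn_gammaIntegrand (by have : (0:ℝ) < mult w := Nat.cast_pos.mpr mult_pos; positivity) hb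
  · -- nonnegativity a.e.: each factor measure lives on `(0, ∞)`
    have hw : ∀ w : InfinitePlace K, ∀ᵐ u ∂((volume : Measure ℝ).restrict (Set.Ioi 0)), 0 < u :=
      fun w ↦ (ae_restrict_iff' measurableSet_Ioi).mpr (Filter.Eventually.of_forall fun u hu ↦ hu)
    have hall : ∀ᵐ y ∂(Measure.pi fun _ : InfinitePlace K ↦ (volume : Measure ℝ).restrict (Set.Ioi 0)),
        ∀ w : InfinitePlace K, 0 < y w :=
      Filter.eventually_all.mpr fun w ↦
        (Measure.tendsto_eval_ae_ae (μ := fun _ : InfinitePlace K ↦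
          (volume : Measure ℝ).restrict (Set.Ioi 0)) (i := w)).eventually (hw w)
    refine hall.mono fun y hy ↦ ?_
    exact Finset.prod_nonneg fun w _ ↦ mul_nonneg (Real.rpow_nonneg (hy w).le _) (Real.exp_nonneg _)



/-! ### Assembly: the Mellin–Gamma identity for a single `a ≠ 0` (Neukirch VII §5, before (5.5)) -/

open scoped Classical in
/-- `X(c,t) = e(2c, (log t)/n)` for the splitting equivalence `e` of
`exists_measurableEquiv_realSpace_split`. [folklore] -/
theorem heckeParam_eq_split (e : (Fin (rank K) → ℝ) × ℝ ≃ᵐ realSpace K)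
    (he : ∀ p, (e p : realSpace K) = fun w ↦
      if hw : w = w₀ then p.2 else p.1 (equivFinRank.symm ⟨w, hw⟩))
    (c : Fin (rank K) → ℝ) (t : ℝ) :
    heckeParam K c t = e ((2 : ℝ) • c, Real.log t / Module.finrank ℚ K) := by
  rw [he]
  funext w
  simp only [heckeParam, Pi.smul_apply, smul_eq_mul]

open scoped Classical in
/-- Joint measurability of `(c, τ) ↦ e^{-π⟨a · expMapBasis(e(c,τ)), a⟩}`-type integrands. [folklore] -/
theorem measurable_thetaSummand_expMapBasis (a : K) :
    Measurable fun x : realSpace K ↦ thetaSummand K (expMapBasis x) a :=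
  (continuous_thetaSummand a).measurable.comp (continuous_expMapBasis K).measurable

open scoped Classical in
/-- **The Gamma integral of Hecke's coordinates** (Neukirch VII §5, the substitution
`y ↦ π|a|²y/d_𝔞^{1/n}` in `Γ_K`, combined with the passage `R_+^* = S × ℝ_+^*` in Hecke's
coordinates): for `a ≠ 0` and `σ > 0`,
`∫_{t>0} t^{σ-1} ∫_{ℝ^{r-1}} e^{-π⟨a y(c,t), a⟩} dc dt
   = 2^{-(r-1)} · n · (2^{-r₂} n R)⁻¹ · ∏_w (π e_w |a|_w²)^{-e_w σ} Γ(e_w σ)`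
(`ℝ≥0∞`-valued). [folklore] -/
theorem lintegral_Ioi_rpow_mul_lintegral_thetaSummand_heckeCoord (a : K) (ha : a ≠ 0) {σ : ℝ}
    (hσ : 0 < σ) :
    ∫⁻ t in Set.Ioi 0, ENNReal.ofReal (t ^ (σ - 1)) *
        ∫⁻ c : Fin (rank K) → ℝ, ENNReal.ofReal (thetaSummand K (heckeCoord K c t) a) =
      ENNReal.ofReal ((2 ^ rank K)⁻¹ * Module.finrank ℚ K *
        (2⁻¹ ^ nrComplexPlaces K * Module.finrank ℚ K * regulator K)⁻¹ *
        ∏ w : InfinitePlace K, (1 / (Real.pi * mult w * (w a) ^ 2)) ^ ((mult w : ℝ) * σ) *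
          Real.Gamma ((mult w : ℝ) * σ)) := by
  obtain ⟨e, hep, he⟩ := exists_measurableEquiv_realSpace_split (K := K)
  set n : ℕ := Module.finrank ℚ K with hn
  have hn0 : (0 : ℝ) < n := Nat.cast_pos.mpr Module.finrank_pos
  set cD : ℝ := 2⁻¹ ^ nrComplexPlaces K * n * regulator K with hcD
  have hcD0 : 0 < cD := by
    have := regulator_pos K
    positivity
  -- the integrand in `x ∈ ℝ^{places}`
  set H : realSpace K → ℝ≥0∞ := fun x ↦
    ENNReal.ofReal (Real.exp (n * σ * x w₀) * thetaSummand K (expMapBasis x) a) with hH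
  have hHm : Measurable H :=
    ((((measurable_pi_apply w₀).const_mul _).exp).mul (measurable_thetaSummand_expMapBasis a)).ennreal_ofReal
  -- Step 1–2: Hecke's coordinates through `e`, and the scaling `c = c'/2`
  have h12 : ∀ t : ℝ, ∫⁻ c : Fin (rank K) → ℝ, ENNReal.ofReal (thetaSummand K (heckeCoord K c t) a) =
      ENNReal.ofReal ((2 ^ rank K)⁻¹) *
        ∫⁻ c : Fin (rank K) → ℝ, ENNReal.ofReal (thetaSummand K (expMapBasis (e (c, Real.log t / n))) a) := by
    intro t
    have := lintegral_comp_two_smul (ι := Fin (rank K))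
      (fun c ↦ ENNReal.ofReal (thetaSummand K (expMapBasis (e (c, Real.log t / n))) a))
    simp only [Fintype.card_fin] at this
    rw [← this]
    refine lintegral_congr fun c ↦ ?_
    rw [← expMapBasis_heckeParam, heckeParam_eq_split e he]
  simp_rw [h12]
  -- Step 3–4: pull the constant, substitute `t = e^{nτ}`
  have h34 : ∫⁻ t in Set.Ioi 0, ENNReal.ofReal (t ^ (σ - 1)) * (ENNReal.ofReal ((2 ^ rank K)⁻¹) *
      ∫⁻ c : Fin (rank K) → ℝ, ENNReal.ofReal (thetaSummand K (expMapBasis (e (c, Real.log t / n))) a)) =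
      ENNReal.ofReal ((2 ^ rank K)⁻¹) * ∫⁻ τ, ENNReal.ofReal (n * Real.exp (n * σ * τ)) *
        ∫⁻ c : Fin (rank K) → ℝ, ENNReal.ofReal (thetaSummand K (expMapBasis (e (c, τ))) a) := by
    rw [← lintegral_Ioi_rpow_mul_comp_log_div hn0 σ, ← lintegral_const_mul' _ _ ENNReal.ofReal_ne_top]
    refine lintegral_congr fun t ↦ ?_
    ring
  rw [h34]
  -- Step 5–6: Tonelli on `ℝ^{r-1} × ℝ` and transport along `e`
  have hw0 : ∀ (c : Fin (rank K) → ℝ) (τ : ℝ), (e (c, τ) : realSpace K) w₀ = τ := fun c τ ↦ by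
    rw [he]; simp
  set f : (Fin (rank K) → ℝ) × ℝ → ℝ≥0∞ := fun z ↦ ENNReal.ofReal n * H (e z) with hf
  have hfm : Measurable f := (hHm.comp e.measurable).const_mul _
  have hpt : ∀ (c : Fin (rank K) → ℝ) (τ : ℝ), ENNReal.ofReal (n * Real.exp (n * σ * τ)) *
      ENNReal.ofReal (thetaSummand K (expMapBasis (e (c, τ))) a) = f (c, τ) := by
    intro c τ
    simp only [hf, hH, hw0]
    rw [ENNReal.ofReal_mul hn0.le, ENNReal.ofReal_mul (Real.exp_pos _).le, mul_assoc]
  have h56 : ∫⁻ τ, ENNReal.ofReal (n * Real.exp (n * σ * τ)) *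
      ∫⁻ c : Fin (rank K) → ℝ, ENNReal.ofReal (thetaSummand K (expMapBasis (e (c, τ))) a) =
      ENNReal.ofReal n * ∫⁻ x : realSpace K, H x := by
    calc ∫⁻ τ, ENNReal.ofReal (n * Real.exp (n * σ * τ)) *
          ∫⁻ c : Fin (rank K) → ℝ, ENNReal.ofReal (thetaSummand K (expMapBasis (e (c, τ))) a)
        = ∫⁻ τ, ∫⁻ c : Fin (rank K) → ℝ, f (c, τ) := by
          refine lintegral_congr fun τ ↦ ?_
          rw [← lintegral_const_mul' _ _ ENNReal.ofReal_ne_top]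
          exact lintegral_congr fun c ↦ hpt c τ
      _ = ∫⁻ z, f z ∂((volume : Measure (Fin (rank K) → ℝ)).prod (volume : Measure ℝ)) :=
          (lintegral_prod_symm f hfm.aemeasurable).symm
      _ = ∫⁻ z, f z := by rw [Measure.volume_eq_prod]
      _ = ENNReal.ofReal n * ∫⁻ z, H (e z) := lintegral_const_mul _ (hHm.comp e.measurable)
      _ = ENNReal.ofReal n * ∫⁻ x : realSpace K, H x := by rw [hep.lintegral_comp hHm]
  rw [h56]
  -- Step 7–8: change of variables to `y` and the Gamma integrals
  have hD := setLIntegral_pi_Ioi_prod_gammaIntegrand_eq_lintegral_expMapBasis (K := K) a σ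
  have hE := setLIntegral_pi_Ioi_prod_gammaIntegrand (K := K) a ha hσ
  rw [← hn] at hD
  rw [hE] at hD
  -- `hD : ofReal ΠΓ = ofReal cD * ∫ H`
  have hHint : ∫⁻ x : realSpace K, H x = (ENNReal.ofReal cD)⁻¹ *
      ENNReal.ofReal (∏ w : InfinitePlace K, (1 / (Real.pi * mult w * (w a) ^ 2)) ^ ((mult w : ℝ) * σ) *
        Real.Gamma ((mult w : ℝ) * σ)) := by
    rw [hD, ← mul_assoc, ENNReal.inv_mul_cancel (ENNReal.ofReal_pos.mpr hcD0).ne' ENNReal.ofReal_ne_top,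
      one_mul]
  have hΓ : 0 ≤ ∏ w : InfinitePlace K, (1 / (Real.pi * mult w * (w a) ^ 2)) ^ ((mult w : ℝ) * σ) *
      Real.Gamma ((mult w : ℝ) * σ) := by
    refine Finset.prod_nonneg fun w _ ↦ mul_nonneg (Real.rpow_nonneg ?_ _) (Real.Gamma_nonneg_of_nonneg ?_)
    · have : (0 : ℝ) < mult w := Nat.cast_pos.mpr mult_pos
      positivity
    · have : (0 : ℝ) < mult w := Nat.cast_pos.mpr mult_pos
      positivity
  rw [hHint, ← ENNReal.ofReal_inv_of_pos hcD0, ← ENNReal.ofReal_mul (inv_nonneg.mpr hcD0.le),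
    ← ENNReal.ofReal_mul hn0.le, ← ENNReal.ofReal_mul (by positivity)]
  congr 1
  ring



/-! ### The Mellin transform of `f - 1` for real `σ`, summed over cone points -/

/-- Joint measurability of `(t, c) ↦ e^{-π⟨a y(c,t), a⟩}`. [folklore] -/
theorem measurable_thetaSummand_heckeCoord_uncurry (a : K) :
    Measurable fun p : ℝ × (Fin (rank K) → ℝ) ↦ thetaSummand K (heckeCoord K p.2 p.1) a := by
  unfold thetaSummand minkowskiQuadForm heckeCoord heckeLogCoord
  fun_prop

/-- `f_𝔞(t) - 1` as an `ℝ≥0∞`-valued cube integral of `θ - 1 ≥ 0`. [folklore] -/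
theorem ofReal_heckeFi_sub_one (I : FractionalIdeal (𝓞 K)⁰ K) (t : ℝ) :
    ENNReal.ofReal (heckeFi K I 1 t - 1) =
      ∫⁻ c in Set.Icc (0 : Fin (rank K) → ℝ) 1, ENNReal.ofReal (thetaIdeal K I (heckeCoord K c t) - 1) := by
  have hsub : heckeFi K I 1 t - 1 =
      ∫ c in Set.Icc (0 : Fin (rank K) → ℝ) 1, (thetaIdeal K I (heckeCoord K c t) - 1) := by
    have hint : IntegrableOn (fun c : Fin (rank K) → ℝ ↦ thetaIdeal K I (heckeCoord K c t))
        (Set.Icc (0 : Fin (rank K) → ℝ) 1) :=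
      (integrableOn_thetaIdeal_heckeCoord I 1 t).congr_fun (fun c _ ↦ by simp only [one_smul])
        measurableSet_Icc
    rw [integral_sub hint (integrableOn_const volume_unitCube_lt_top.ne), setIntegral_unitCube_const,
      heckeFi]
    congr 1
    exact setIntegral_congr_fun measurableSet_Icc fun c _ ↦ by simp only [one_smul]
  rw [hsub, ofReal_integral_eq_lintegral_ofReal]
  · exact ((integrableOn_thetaIdeal_heckeCoord I 1 t).congr_fun (fun c _ ↦ by simp only [one_smul])
      measurableSet_Icc).sub (integrableOn_const volume_unitCube_lt_top.ne)
  · exact Filter.Eventually.of_forall fun c ↦ sub_nonneg.mpr (one_le_thetaIdeal K I (heckeCoord_pos c t))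

/-- **The Mellin transform of `f - 1` at real `σ > 0`, unfolded** (Neukirch VII (5.5) with the
Gamma integrals evaluated, summed over the cone representatives):
`∫_{t>0} t^{σ-1} (f_𝔞(t) - 1) dt = ∑_{a ∈ cone pts of 𝔞} 2^{-(r-1)} n (2^{-r₂} n R)⁻¹ ∏_w (π e_w |a|_w²)^{-e_wσ} Γ(e_wσ)`
(`ℝ≥0∞`-valued; both sides may be `∞` for `σ ≤ 1/2`). [folklore] -/
theorem lintegral_Ioi_rpow_mul_heckeFi_sub_one (I : FractionalIdeal (𝓞 K)⁰ K) {σ : ℝ} (hσ : 0 < σ) :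
    ∫⁻ t in Set.Ioi 0, ENNReal.ofReal (t ^ (σ - 1)) * ENNReal.ofReal (heckeFi K I 1 t - 1) =
      ∑' a : conePoints K I, ENNReal.ofReal ((2 ^ rank K)⁻¹ * Module.finrank ℚ K *
        (2⁻¹ ^ nrComplexPlaces K * Module.finrank ℚ K * regulator K)⁻¹ *
        ∏ w : InfinitePlace K, (1 / (Real.pi * mult w * (w (a : K)) ^ 2)) ^ ((mult w : ℝ) * σ) *
          Real.Gamma ((mult w : ℝ) * σ)) := by
  haveI := countable_conePoints I
  simp_rw [ofReal_heckeFi_sub_one, lintegral_unitCube_thetaIdeal_sub_one]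
  have hmeas : ∀ a : conePoints K I, AEMeasurable (fun t : ℝ ↦ ENNReal.ofReal (t ^ (σ - 1)) *
      ∫⁻ c : Fin (rank K) → ℝ, ENNReal.ofReal (thetaSummand K (heckeCoord K c t) (a : K)))
      (volume.restrict (Set.Ioi 0)) := fun a ↦ by
    refine ((measurable_id.pow_const _).ennreal_ofReal.mul ?_).aemeasurable
    exact (measurable_thetaSummand_heckeCoord_uncurry (K := K) (a : K)).ennreal_ofReal.lintegral_prod_right'
  calc ∫⁻ t in Set.Ioi 0, ENNReal.ofReal (t ^ (σ - 1)) *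
        ∑' a : conePoints K I, ∫⁻ c : Fin (rank K) → ℝ,
          ENNReal.ofReal (thetaSummand K (heckeCoord K c t) (a : K))
      = ∫⁻ t in Set.Ioi 0, ∑' a : conePoints K I, ENNReal.ofReal (t ^ (σ - 1)) *
          ∫⁻ c : Fin (rank K) → ℝ, ENNReal.ofReal (thetaSummand K (heckeCoord K c t) (a : K)) := by
        simp_rw [ENNReal.tsum_mul_left]
    _ = ∑' a : conePoints K I, ∫⁻ t in Set.Ioi 0, ENNReal.ofReal (t ^ (σ - 1)) *
          ∫⁻ c : Fin (rank K) → ℝ, ENNReal.ofReal (thetaSummand K (heckeCoord K c t) (a : K)) :=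
        lintegral_tsum hmeas
    _ = _ := tsum_congr fun a ↦
        lintegral_Ioi_rpow_mul_lintegral_thetaSummand_heckeCoord (a : K) (ne_zero_of_mem_conePoints a.2) hσ


/-! ### The Gamma factor and the norm: `∏_w |a|_w^{-2e_wσ} = |N(a)|^{-2σ}` -/

/-- **Separating the norm**: `∏_w (π e_w |a|_w²)^{-e_wσ} Γ(e_wσ) = [∏_w (π e_w)^{-e_wσ} Γ(e_wσ)] · |N_{K/ℚ}(a)|^{-2σ}`
(`∏_w |a|_w^{e_w} = |N(a)|`, Mathlib `prod_eq_abs_norm`; Neukirch VII §5: `𝔑((a)) = |N(a)|`). [folklore] -/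
theorem prod_gammaFactor_eq_mul_norm_rpow (a : K) (ha : a ≠ 0) (σ : ℝ) :
    ∏ w : InfinitePlace K, (1 / (Real.pi * mult w * (w a) ^ 2)) ^ ((mult w : ℝ) * σ) *
        Real.Gamma ((mult w : ℝ) * σ) =
      (∏ w : InfinitePlace K, (1 / (Real.pi * mult w)) ^ ((mult w : ℝ) * σ) * Real.Gamma ((mult w : ℝ) * σ)) *
        (|(Algebra.norm ℚ a : ℚ)| : ℝ) ^ (-2 * σ) := by
  have hwpos : ∀ w : InfinitePlace K, 0 < w a := fun w ↦ pos_iff.mpr ha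
  -- split each factor
  have hfac : ∀ w : InfinitePlace K, (1 / (Real.pi * mult w * (w a) ^ 2)) ^ ((mult w : ℝ) * σ) =
      (1 / (Real.pi * mult w)) ^ ((mult w : ℝ) * σ) * ((w a) ^ mult w) ^ (-2 * σ) := by
    intro w
    have hm : (0 : ℝ) < mult w := Nat.cast_pos.mpr mult_pos
    have h1 : (0 : ℝ) ≤ 1 / (Real.pi * mult w) := by positivity
    rw [show (1 : ℝ) / (Real.pi * mult w * (w a) ^ 2) = (1 / (Real.pi * mult w)) * ((w a) ^ 2)⁻¹ by
      field_simp, Real.mul_rpow h1 (inv_nonneg.mpr (sq_nonneg _))]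
    congr 1
    rw [Real.inv_rpow (sq_nonneg _), ← Real.rpow_neg (sq_nonneg _), ← Real.rpow_natCast,
      ← Real.rpow_natCast, ← Real.rpow_mul (hwpos w).le, ← Real.rpow_mul (hwpos w).le]
    congr 1
    push_cast
    ring
  simp_rw [hfac]
  rw [Finset.prod_mul_distrib, Finset.prod_mul_distrib, Finset.prod_mul_distrib,
    Real.finsetProd_rpow _ _ (fun w _ ↦ pow_nonneg (hwpos w).le _), prod_eq_abs_norm]
  push_cast
  ring

/-! ## Cone points, principal ideals and ideal classes (Neukirch VII (5.3), (5.4))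

The combinatorial half of the identification of `L(f_𝔞 - 1, s)` with the partial zeta function:
`∑_{a ∈ cone pts of J} |N(a)|^{-σ} = w · 𝔑(J)^{-σ} · ∑_{I ∈ C} 𝔑(I)^{-σ}` for `mk0 J = C⁻¹`. -/


/-- Cone points of an integral ideal `J` (as a fractional ideal) correspond to the points of Mathlib's
`idealSet K J` (`= fundamentalCone ∩ j(J)`) under `a ↦ j(a)`. [folklore] -/
theorem exists_conePoints_equiv_idealSet (J : (Ideal (𝓞 K))⁰) :
    ∃ β : conePoints K ((J : Ideal (𝓞 K)) : FractionalIdeal (𝓞 K)⁰ K) ≃ idealSet K J,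
      ∀ a, ((β a : idealSet K J) : mixedSpace K) = mixedEmbedding K (a : K) := by
  classical
  -- forward map
  have hmem : ∀ a : conePoints K ((J : Ideal (𝓞 K)) : FractionalIdeal (𝓞 K)⁰ K),
      mixedEmbedding K (a : K) ∈ idealSet K J := by
    rintro ⟨a, ha, hc⟩
    obtain ⟨x, hx, rfl⟩ := (FractionalIdeal.mem_coeIdeal _).mp ha
    exact mem_idealSet.mpr ⟨hc, x, hx, rfl⟩
  let f : conePoints K ((J : Ideal (𝓞 K)) : FractionalIdeal (𝓞 K)⁰ K) → idealSet K J :=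
    fun a ↦ ⟨mixedEmbedding K (a : K), hmem a⟩
  have hf : Function.Bijective f := by
    constructor
    · intro a b hab
      exact Subtype.ext (NumberField.mixedEmbedding_injective K (congr_arg Subtype.val hab))
    · rintro ⟨x, hx⟩
      obtain ⟨hc, y, hy, rfl⟩ := mem_idealSet.mp hx
      refine ⟨⟨(y : K), (FractionalIdeal.mem_coeIdeal _).mpr ⟨y, hy, rfl⟩, hc⟩, rfl⟩
  exact ⟨Equiv.ofBijective f hf, fun a ↦ rfl⟩

/-- The norm of a cone point: `N(j(a)) = |N_{K/ℚ}(a)|` (Mathlib `norm_eq_norm`). [folklore] -/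
theorem norm_mixedEmbedding_eq_abs_norm (a : K) :
    mixedEmbedding.norm (mixedEmbedding K a) = |(Algebra.norm ℚ a : ℚ)| := by
  rw [norm_eq_norm]

/-- Regrouping an `ℝ≥0∞`-valued sum along the fibres of a map with finite fibres:
`∑_x f(N x) = ∑_n #{x | N x = n} · f n`. [folklore] -/
theorem ENNReal.tsum_comp_eq_tsum_card_fiber_mul {X : Type*} (N : X → ℕ)
    (hN : ∀ n, Finite {x // N x = n}) (f : ℕ → ℝ≥0∞) :
    ∑' x, f (N x) = ∑' n, (Nat.card {x // N x = n} : ℝ≥0∞) * f n := by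
  rw [← (Equiv.sigmaFiberEquiv N).tsum_eq, ENNReal.tsum_sigma']
  refine tsum_congr fun n ↦ ?_
  haveI := hN n
  haveI := Fintype.ofFinite {x // N x = n}
  rw [tsum_fintype]
  simp only [Equiv.sigmaFiberEquiv, Equiv.coe_fn_mk]
  rw [Finset.sum_congr rfl (fun (x : {x // N x = n}) _ ↦ by rw [x.2]), Finset.sum_const, Finset.card_univ,
    nsmul_eq_mul, Nat.card_eq_fintype_card]


/-- **Points of the ideal set versus principal ideals** (Neukirch VII (5.3):
`𝔞^*/𝒪^* ≅ {𝔟 ∈ [𝔞⁻¹] integral}`, `𝔟 = a𝔞⁻¹`; with Mathlib's fundamental cone each class of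
associates is met `w = #μ(K)` times — Mathlib `idealSetEquivNorm`): for an integral ideal `J` and any
`φ : ℕ → ℝ≥0∞`, `∑_{x ∈ idealSet J} φ(N x) = w · ∑_{I principal, J ∣ I} φ(𝔑(I))`.
[cite: NeukirchANT1999, Ch. VII (5.3)] -/
theorem tsum_idealSet_eq_torsionOrder_mul_tsum (J : (Ideal (𝓞 K))⁰) (φ : ℕ → ℝ≥0∞) :
    ∑' x : idealSet K J, φ (intNorm (idealSetEquiv K J x).1) =
      (torsionOrder K : ℝ≥0∞) *
        ∑' I : {I : (Ideal (𝓞 K))⁰ // (J : Ideal (𝓞 K)) ∣ I ∧ Submodule.IsPrincipal (I : Ideal (𝓞 K))},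
          φ (Ideal.absNorm (I.1 : Ideal (𝓞 K))) := by
  classical
  set Sub := {I : (Ideal (𝓞 K))⁰ // (J : Ideal (𝓞 K)) ∣ I ∧ Submodule.IsPrincipal (I : Ideal (𝓞 K))}
  -- finiteness of the norm fibres of `Sub`
  haveI hfinI : ∀ n, Finite {I : Sub // Ideal.absNorm (I.1.1 : Ideal (𝓞 K)) = n} := by
    intro n
    haveI : Finite {I : Ideal (𝓞 K) // Ideal.absNorm I = n} := (Ideal.finite_setOf_absNorm_eq n).to_subtype
    refine Finite.of_injective (fun I ↦ (⟨(I.1.1 : Ideal (𝓞 K)), I.2⟩ :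
      {I : Ideal (𝓞 K) // Ideal.absNorm I = n})) fun a b hab ↦ ?_
    have h : ((a.1.1 : Ideal (𝓞 K))) = (b.1.1 : Ideal (𝓞 K)) := by
      simpa using congr_arg (fun I : {I : Ideal (𝓞 K) // Ideal.absNorm I = n} ↦ (I : Ideal (𝓞 K))) hab
    exact Subtype.ext (Subtype.ext (Subtype.ext h))
  -- the fibre equivalences (Mathlib `idealSetEquivNorm`)
  have E : ∀ n, {x : idealSet K J // intNorm (idealSetEquiv K J x).1 = n} ≃
      {I : Sub // Ideal.absNorm (I.1.1 : Ideal (𝓞 K)) = n} × torsion K := fun n ↦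
    (Equiv.subtypeEquivRight (fun x ↦ by rw [← intNorm_idealSetEquiv_apply, Nat.cast_inj])).trans
      ((idealSetEquivNorm K J n).trans (Equiv.prodCongr
        ((Equiv.subtypeEquivRight (fun I ↦ and_assoc.symm)).trans
          (Equiv.subtypeSubtypeEquivSubtypeInter (fun I : (Ideal (𝓞 K))⁰ ↦ (J : Ideal (𝓞 K)) ∣ I ∧
            Submodule.IsPrincipal (I : Ideal (𝓞 K))) (fun I ↦ Ideal.absNorm (I : Ideal (𝓞 K)) = n)).symm)
        (Equiv.refl _)))
  haveI hfinx : ∀ n, Finite {x : idealSet K J // intNorm (idealSetEquiv K J x).1 = n} := fun n ↦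
    Finite.of_equiv _ (E n).symm
  have hcard : ∀ n, (Nat.card {x : idealSet K J // intNorm (idealSetEquiv K J x).1 = n} : ℝ≥0∞) =
      (torsionOrder K : ℝ≥0∞) * Nat.card {I : Sub // Ideal.absNorm (I.1.1 : Ideal (𝓞 K)) = n} := by
    intro n
    rw [Nat.card_congr (E n), Nat.card_prod, torsionOrder, Nat.cast_mul, mul_comm]
  rw [ENNReal.tsum_comp_eq_tsum_card_fiber_mul (fun x : idealSet K J ↦ intNorm (idealSetEquiv K J x).1)
      hfinx φ,
    ENNReal.tsum_comp_eq_tsum_card_fiber_mul (fun I : Sub ↦ Ideal.absNorm (I.1.1 : Ideal (𝓞 K))) hfinI φ,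
    ← ENNReal.tsum_mul_left]
  refine tsum_congr fun n ↦ ?_
  rw [hcard, mul_assoc]

/-- **Ideals of a class versus principal multiples of a representative** (Neukirch VII (5.3), the
bijection `𝔟 ↦ a = 𝔟𝔞` between the integral ideals of the class `𝔎 = [𝔞⁻¹]` and `𝔞^*/𝒪^*`, in ideal
form): if `mk0 J = C⁻¹` then `I ↦ J·I` is a bijection from the nonzero integral ideals of class `C` onto
the principal ideals divisible by `J` (Mathlib `Equiv.dvd`, `ClassGroup.mk0_eq_one_iff`).
[cite: NeukirchANT1999, Ch. VII (5.3)] -/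
theorem exists_classEquiv (C : ClassGroup (𝓞 K)) (J : (Ideal (𝓞 K))⁰) (hJ : ClassGroup.mk0 J = C⁻¹) :
    ∃ γ : {I : (Ideal (𝓞 K))⁰ // ClassGroup.mk0 I = C} ≃
        {I : (Ideal (𝓞 K))⁰ // (J : Ideal (𝓞 K)) ∣ I ∧ Submodule.IsPrincipal (I : Ideal (𝓞 K))},
      ∀ I, ((γ I).1 : Ideal (𝓞 K)) = J * I.1 := by
  -- `mk0 I = C ↔ J * I principal`
  have key : ∀ I : (Ideal (𝓞 K))⁰, ClassGroup.mk0 I = C ↔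
      Submodule.IsPrincipal (((Equiv.dvd J I : {a : (Ideal (𝓞 K))⁰ // J ∣ a}).1 : (Ideal (𝓞 K))⁰) :
        Ideal (𝓞 K)) := by
    intro I
    rw [Equiv.dvd_apply, ← ClassGroup.mk0_eq_one_iff (SetLike.coe_mem (J * I)), Subtype.coe_eta,
      map_mul, hJ, inv_mul_eq_one, eq_comm]
  let γ₁ : {I : (Ideal (𝓞 K))⁰ // ClassGroup.mk0 I = C} ≃
      {a : {a : (Ideal (𝓞 K))⁰ // J ∣ a} // Submodule.IsPrincipal ((a.1 : (Ideal (𝓞 K))⁰) : Ideal (𝓞 K))} :=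
    (Equiv.dvd J).subtypeEquiv key
  let γ₂ : {a : {a : (Ideal (𝓞 K))⁰ // J ∣ a} // Submodule.IsPrincipal ((a.1 : (Ideal (𝓞 K))⁰) : Ideal (𝓞 K))} ≃
      {I : (Ideal (𝓞 K))⁰ // (J : Ideal (𝓞 K)) ∣ I ∧ Submodule.IsPrincipal (I : Ideal (𝓞 K))} :=
    (Equiv.subtypeSubtypeEquivSubtypeInter (fun a : (Ideal (𝓞 K))⁰ ↦ J ∣ a)
      (fun a ↦ Submodule.IsPrincipal ((a : (Ideal (𝓞 K))⁰) : Ideal (𝓞 K)))).trans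
      (Equiv.subtypeEquivRight fun I ↦ by rw [nonZeroDivisors_dvd_iff_dvd_coe])
  refine ⟨γ₁.trans γ₂, fun I ↦ ?_⟩
  rfl

/-- **The cone-point Dirichlet series of an integral ideal versus its class partial zeta function**
(Neukirch VII (5.3), (5.4): `ζ(𝔎, s) = 𝔑(𝔞)^s ∑_{a ∈ 𝔞^*/𝒪^*} |N(a)|^{-s}`, here with the cone
representatives, each class of associates counted `w` times): for an integral ideal `J` with
`mk0 J = C⁻¹` and real `σ`,
`∑_{a ∈ cone pts of J} |N(a)|^{-σ} = w · 𝔑(J)^{-σ} · ∑_{I ∈ C} 𝔑(I)^{-σ}` (`ℝ≥0∞`-valued).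
[cite: NeukirchANT1999, Ch. VII (5.4)] -/
theorem tsum_conePoints_norm_rpow_eq (C : ClassGroup (𝓞 K)) (J : (Ideal (𝓞 K))⁰)
    (hJ : ClassGroup.mk0 J = C⁻¹) (σ : ℝ) :
    ∑' a : conePoints K ((J : Ideal (𝓞 K)) : FractionalIdeal (𝓞 K)⁰ K),
        ENNReal.ofReal ((|(Algebra.norm ℚ (a : K) : ℚ)| : ℝ) ^ (-σ)) =
      (torsionOrder K : ℝ≥0∞) * ENNReal.ofReal ((Ideal.absNorm (J : Ideal (𝓞 K)) : ℝ) ^ (-σ)) *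
        ∑' I : {I : (Ideal (𝓞 K))⁰ // ClassGroup.mk0 I = C},
          ENNReal.ofReal ((Ideal.absNorm (I.1 : Ideal (𝓞 K)) : ℝ) ^ (-σ)) := by
  classical
  obtain ⟨β, hβ⟩ := exists_conePoints_equiv_idealSet (K := K) J
  obtain ⟨γ, hγ⟩ := exists_classEquiv C J hJ
  set φ : ℕ → ℝ≥0∞ := fun n ↦ ENNReal.ofReal ((n : ℝ) ^ (-σ)) with hφ
  -- cone points → ideal set
  have h1 : ∑' a : conePoints K ((J : Ideal (𝓞 K)) : FractionalIdeal (𝓞 K)⁰ K),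
      ENNReal.ofReal ((|(Algebra.norm ℚ (a : K) : ℚ)| : ℝ) ^ (-σ)) =
      ∑' x : idealSet K J, φ (intNorm (idealSetEquiv K J x).1) := by
    rw [← β.symm.tsum_eq]
    refine tsum_congr fun x ↦ ?_
    simp only [hφ]
    congr 2
    have hx : ((β (β.symm x) : idealSet K J) : mixedSpace K) = mixedEmbedding K ((β.symm x : _) : K) := hβ _
    rw [Equiv.apply_symm_apply] at hx
    rw [intNorm_idealSetEquiv_apply, hx, norm_eq_norm, Rat.cast_abs]
  -- class ideals → principal multiples of `J`
  have h3 : ∑' I : {I : (Ideal (𝓞 K))⁰ // (J : Ideal (𝓞 K)) ∣ I ∧ Submodule.IsPrincipal (I : Ideal (𝓞 K))},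
      φ (Ideal.absNorm (I.1 : Ideal (𝓞 K))) =
      ENNReal.ofReal ((Ideal.absNorm (J : Ideal (𝓞 K)) : ℝ) ^ (-σ)) *
        ∑' I : {I : (Ideal (𝓞 K))⁰ // ClassGroup.mk0 I = C},
          ENNReal.ofReal ((Ideal.absNorm (I.1 : Ideal (𝓞 K)) : ℝ) ^ (-σ)) := by
    rw [← γ.tsum_eq, ← ENNReal.tsum_mul_left]
    refine tsum_congr fun I ↦ ?_
    simp only [hφ]
    rw [hγ I, map_mul, Nat.cast_mul,
      Real.mul_rpow (Nat.cast_nonneg _) (Nat.cast_nonneg _),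
      ENNReal.ofReal_mul (Real.rpow_nonneg (Nat.cast_nonneg _) _)]
  rw [h1, tsum_idealSet_eq_torsionOrder_mul_tsum, h3, mul_assoc]



/-! ### (iv) The completed Mellin transform `Λ(σ)` at real `σ > 1/2` -/

/-- For real `σ > 1/2`, `Λ_𝔞(σ)` (Mathlib's `WeakFEPair.Λ` of `heckePair`) is the real number
`∫_{t>0} t^{σ-1} (f_𝔞(t) - 1) dt`, computed as an `ℝ≥0∞`-valued integral; in particular that
integral is finite (`WeakFEPair.hasMellin`; Neukirch VII (5.9): `Z(𝔎, s) = L(f, s/2)` for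
`Re(s) > 1`). [folklore] -/
theorem heckePair_Λ_ofReal (hinv : thetaIdeal_inv K) (I : FractionalIdeal (𝓞 K)⁰ K) (hI : I ≠ 0)
    {σ : ℝ} (hσ : 1 / 2 < σ) :
    ∫⁻ t in Set.Ioi 0, ENNReal.ofReal (t ^ (σ - 1)) * ENNReal.ofReal (heckeFi K I 1 t - 1) ≠ ⊤ ∧
    (heckePair K hinv I hI).Λ σ =
      ((∫⁻ t in Set.Ioi 0, ENNReal.ofReal (t ^ (σ - 1)) * ENNReal.ofReal (heckeFi K I 1 t - 1)).toReal : ℂ) := by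
  set P := heckePair K hinv I hI with hP
  have hk : P.k < (σ : ℂ).re := by simp only [hP, heckePair, Complex.ofReal_re]; exact hσ
  obtain ⟨hconv, hmel⟩ := P.hasMellin hk
  set g : ℝ → ℝ := fun t ↦ t ^ (σ - 1) * (heckeFi K I 1 t - 1) with hg
  -- the complex integrand is the cast of the real one
  have hint_eq : Set.EqOn (fun t : ℝ ↦ (t : ℂ) ^ ((σ : ℂ) - 1) • (P.f t - P.f₀))
      (fun t : ℝ ↦ ((g t : ℝ) : ℂ)) (Set.Ioi 0) := by
    intro t ht
    simp only [hP, heckePair, smul_eq_mul, hg]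
    rw [Complex.ofReal_mul, Complex.ofReal_sub, Complex.ofReal_one, Complex.ofReal_cpow (le_of_lt ht)]
    push_cast
    ring
  have hconvR : IntegrableOn g (Set.Ioi 0) := by
    have h := (IntegrableOn.congr_fun hconv hint_eq measurableSet_Ioi).re
    exact IntegrableOn.congr_fun h (fun t _ ↦ by simp) measurableSet_Ioi
  have hnn : 0 ≤ᵐ[volume.restrict (Set.Ioi 0)] g :=
    (ae_restrict_iff' measurableSet_Ioi).mpr (Filter.Eventually.of_forall fun t (ht : 0 < t) ↦
      mul_nonneg (Real.rpow_nonneg ht.le _) (sub_nonneg.mpr (one_le_heckeFi I 1 t)))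
  have hlin : ∫⁻ t in Set.Ioi 0, ENNReal.ofReal (t ^ (σ - 1)) * ENNReal.ofReal (heckeFi K I 1 t - 1) =
      ENNReal.ofReal (∫ t in Set.Ioi 0, g t) := by
    rw [ofReal_integral_eq_lintegral_ofReal hconvR hnn]
    refine setLIntegral_congr_fun measurableSet_Ioi fun t (ht : 0 < t) ↦ ?_
    rw [hg, ← ENNReal.ofReal_mul (Real.rpow_nonneg ht.le _)]
  refine ⟨by rw [hlin]; exact ENNReal.ofReal_ne_top, ?_⟩
  have hcast : ∫ t in Set.Ioi 0, ((g t : ℝ) : ℂ) = ((∫ t in Set.Ioi 0, g t : ℝ) : ℂ) := integral_ofReal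
  rw [← hmel, mellin, setIntegral_congr_fun measurableSet_Ioi hint_eq, hcast, hlin,
    ENNReal.toReal_ofReal (integral_nonneg_of_ae hnn)]


/-! ### The real-`σ` identity `Λ_J(σ) = A(σ) · w · 𝔑(J)^{-2σ} · ∑_{I ∈ C} 𝔑(I)^{-2σ}` -/

/-- An integral nonzero ideal is nonzero as a fractional ideal. [folklore] -/
theorem coeIdeal_ne_zero_of_mem_nonZeroDivisors (J : (Ideal (𝓞 K))⁰) :
    ((J : Ideal (𝓞 K)) : FractionalIdeal (𝓞 K)⁰ K) ≠ 0 :=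
  FractionalIdeal.coeIdeal_ne_zero.mpr (nonZeroDivisors.coe_ne_zero J)

/-- **`Z(𝔎, 2σ)` unfolded at real `σ > 1/2`** (Neukirch VII (5.5) with (5.3), (5.4) and the Gamma
integrals (4.2) evaluated, in Hecke's coordinates and Mathlib's fundamental cone): for an integral
ideal `J` with `mk0 J = C⁻¹`,
`Λ_J(σ) = A(σ) · w · 𝔑(J)^{-2σ} · ∑_{I ∈ C} 𝔑(I)^{-2σ}`,
`A(σ) = 2^{-(r-1)} n (2^{-r₂} n R)⁻¹ ∏_w (π e_w)^{-e_wσ} Γ(e_wσ)`, and the class sum is finite.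
[cite: NeukirchANT1999, Ch. VII (5.5)] -/
theorem heckePair_Λ_real_eq (hinv : thetaIdeal_inv K) (C : ClassGroup (𝓞 K)) (J : (Ideal (𝓞 K))⁰)
    (hJ : ClassGroup.mk0 J = C⁻¹) {σ : ℝ} (hσ : 1 / 2 < σ) :
    (∑' I : {I : (Ideal (𝓞 K))⁰ // ClassGroup.mk0 I = C},
        ENNReal.ofReal ((Ideal.absNorm (I.1 : Ideal (𝓞 K)) : ℝ) ^ (-(2 * σ)))) ≠ ⊤ ∧
    (heckePair K hinv _ (coeIdeal_ne_zero_of_mem_nonZeroDivisors J)).Λ σ =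
      (((2 ^ rank K)⁻¹ * Module.finrank ℚ K * (2⁻¹ ^ nrComplexPlaces K * Module.finrank ℚ K * regulator K)⁻¹ *
        (∏ w : InfinitePlace K, (1 / (Real.pi * mult w)) ^ ((mult w : ℝ) * σ) * Real.Gamma ((mult w : ℝ) * σ)) *
        torsionOrder K * (Ideal.absNorm (J : Ideal (𝓞 K)) : ℝ) ^ (-(2 * σ)) *
        (∑' I : {I : (Ideal (𝓞 K))⁰ // ClassGroup.mk0 I = C},
          ENNReal.ofReal ((Ideal.absNorm (I.1 : Ideal (𝓞 K)) : ℝ) ^ (-(2 * σ)))).toReal : ℝ) : ℂ) := by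
  have hσ0 : 0 < σ := lt_trans (by norm_num) hσ
  obtain ⟨hfin, hΛ⟩ := heckePair_Λ_ofReal hinv _ (coeIdeal_ne_zero_of_mem_nonZeroDivisors J) hσ
  set Cst : ℝ := (2 ^ rank K)⁻¹ * Module.finrank ℚ K *
    (2⁻¹ ^ nrComplexPlaces K * Module.finrank ℚ K * regulator K)⁻¹ with hCst
  set G : ℝ := ∏ w : InfinitePlace K, (1 / (Real.pi * mult w)) ^ ((mult w : ℝ) * σ) *
    Real.Gamma ((mult w : ℝ) * σ) with hG
  set S : ℝ≥0∞ := ∑' I : {I : (Ideal (𝓞 K))⁰ // ClassGroup.mk0 I = C},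
    ENNReal.ofReal ((Ideal.absNorm (I.1 : Ideal (𝓞 K)) : ℝ) ^ (-(2 * σ))) with hS
  have hCst0 : 0 < Cst := by
    have := regulator_pos K
    have : (0 : ℝ) < Module.finrank ℚ K := Nat.cast_pos.mpr Module.finrank_pos
    positivity
  have hG0 : 0 ≤ G := Finset.prod_nonneg fun w _ ↦ by
    have : (0 : ℝ) < mult w := Nat.cast_pos.mpr mult_pos
    exact mul_nonneg (Real.rpow_nonneg (by positivity) _) (Real.Gamma_nonneg_of_nonneg (by positivity))
  -- the `ℝ≥0∞` computation
  have hL : ∫⁻ t in Set.Ioi 0, ENNReal.ofReal (t ^ (σ - 1)) *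
      ENNReal.ofReal (heckeFi K ((J : Ideal (𝓞 K)) : FractionalIdeal (𝓞 K)⁰ K) 1 t - 1) =
      ENNReal.ofReal (Cst * G) * ((torsionOrder K : ℝ≥0∞) *
        ENNReal.ofReal ((Ideal.absNorm (J : Ideal (𝓞 K)) : ℝ) ^ (-(2 * σ))) * S) := by
    rw [lintegral_Ioi_rpow_mul_heckeFi_sub_one _ hσ0, ← tsum_conePoints_norm_rpow_eq C J hJ (2 * σ),
      ← ENNReal.tsum_mul_left]
    refine tsum_congr fun a ↦ ?_
    rw [prod_gammaFactor_eq_mul_norm_rpow (a : K) (ne_zero_of_mem_conePoints a.2) σ, ← hG, neg_mul,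
      ← mul_assoc, ← ENNReal.ofReal_mul (mul_nonneg hCst0.le hG0)]
  have hGpos : 0 < G := Finset.prod_pos fun w _ ↦ by
    have : (0 : ℝ) < mult w := Nat.cast_pos.mpr mult_pos
    exact mul_pos (Real.rpow_pos_of_pos (by positivity) _) (Real.Gamma_pos_of_pos (by positivity))
  -- finiteness of the class sum
  have hS : S ≠ ⊤ := by
    intro hS'
    apply hfin
    have hc : ENNReal.ofReal (Cst * G) ≠ 0 := (ENNReal.ofReal_pos.mpr (mul_pos hCst0 hGpos)).ne'
    have hw : (torsionOrder K : ℝ≥0∞) * ENNReal.ofReal ((Ideal.absNorm (J : Ideal (𝓞 K)) : ℝ) ^ (-(2 * σ))) ≠ 0 := by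
      refine mul_ne_zero ?_ ?_
      · exact_mod_cast (torsionOrder_ne_zero K)
      · exact (ENNReal.ofReal_pos.mpr (Real.rpow_pos_of_pos (Nat.cast_pos.mpr
          (Ideal.absNorm_pos_of_nonZeroDivisors J)) _)).ne'
    rw [hL, hS', ENNReal.mul_top hw, ENNReal.mul_top hc]
  refine ⟨hS, ?_⟩
  rw [hΛ, hL]
  congr 1
  rw [ENNReal.toReal_mul, ENNReal.toReal_mul, ENNReal.toReal_mul, ENNReal.toReal_ofReal (mul_nonneg hCst0.le hG0),
    ENNReal.toReal_natCast, ENNReal.toReal_ofReal (Real.rpow_nonneg (Nat.cast_nonneg _) _)]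
  ring


/-! ## (v) Complexification: the class sum and the identity theorem -/

/-- The norm of a nonzero integral ideal is a positive natural number. [folklore] -/
theorem one_le_absNorm_of_mem_nonZeroDivisors (I : (Ideal (𝓞 K))⁰) : 1 ≤ Ideal.absNorm (I : Ideal (𝓞 K)) :=
  Ideal.absNorm_pos_of_nonZeroDivisors I

/-- Summability of `∑_{I ∈ C} ‖𝔑(I)^{-s}‖` for `Re(s) > 1` (from the tree's `summable_norm_absNorm_cpow`,
all ideals). [folklore] -/
theorem summable_norm_classSum_term (C : ClassGroup (𝓞 K)) {s : ℂ} (hs : 1 < s.re) :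
    Summable fun I : {I : (Ideal (𝓞 K))⁰ // ClassGroup.mk0 I = C} ↦
      ‖((Ideal.absNorm (I.1 : Ideal (𝓞 K)) : ℕ) : ℂ) ^ (-s)‖ := by
  have h := Literature.NumberTheory.LFunctions.summable_norm_absNorm_cpow K hs
  exact h.comp_injective (i := fun I : {I : (Ideal (𝓞 K))⁰ // ClassGroup.mk0 I = C} ↦ (I.1 : Ideal (𝓞 K)))
    fun a b hab ↦ Subtype.ext (Subtype.ext hab)

/-- **The class sum `T_C(s) = ∑_{I ∈ C} 𝔑(I)^{-s}` is holomorphic on `Re(s) > 1`** (locally uniform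
convergence, Mathlib `differentiableOn_tsum_of_summable_norm`). [folklore] -/
theorem differentiableOn_classSum (C : ClassGroup (𝓞 K)) :
    DifferentiableOn ℂ (fun s : ℂ ↦ ∑' I : {I : (Ideal (𝓞 K))⁰ // ClassGroup.mk0 I = C},
      ((Ideal.absNorm (I.1 : Ideal (𝓞 K)) : ℕ) : ℂ) ^ (-s)) {s | 1 < s.re} := by
  intro s hs
  obtain ⟨δ, hδ, hδs⟩ : ∃ δ : ℝ, 0 < δ ∧ 1 + δ < s.re :=
    ⟨(s.re - 1) / 2, by simp only [Set.mem_setOf_eq] at hs; linarith,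
      by simp only [Set.mem_setOf_eq] at hs; linarith⟩
  have hopen : IsOpen {z : ℂ | 1 + δ < z.re} := isOpen_lt continuous_const Complex.continuous_re
  suffices h : DifferentiableOn ℂ (fun s : ℂ ↦ ∑' I : {I : (Ideal (𝓞 K))⁰ // ClassGroup.mk0 I = C},
      ((Ideal.absNorm (I.1 : Ideal (𝓞 K)) : ℕ) : ℂ) ^ (-s)) {z : ℂ | 1 + δ < z.re} from
    (h.differentiableAt (hopen.mem_nhds hδs)).differentiableWithinAt
  have hsum := summable_norm_classSum_term C (s := (1 + δ : ℝ)) (by simp; linarith)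
  refine Complex.differentiableOn_tsum_of_summable_norm hsum (fun I ↦ ?_) hopen (fun I z hz ↦ ?_)
  · intro z _
    refine DifferentiableAt.differentiableWithinAt ?_
    refine DifferentiableAt.const_cpow differentiableAt_id.neg (Or.inl ?_)
    exact_mod_cast (Ideal.absNorm_pos_of_nonZeroDivisors I.1).ne'
  · -- `‖𝔑(I)^{-z}‖ = 𝔑(I)^{-re z} ≤ 𝔑(I)^{-(1+δ)}`
    have hN : 0 < Ideal.absNorm (I.1 : Ideal (𝓞 K)) := Ideal.absNorm_pos_of_nonZeroDivisors I.1
    have hz' : 1 + δ < z.re := hz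
    rw [Complex.norm_natCast_cpow_of_pos hN, Complex.norm_natCast_cpow_of_pos hN, Complex.neg_re,
      Complex.neg_re, Complex.ofReal_re]
    exact Real.rpow_le_rpow_of_exponent_le (by exact_mod_cast hN) (by linarith)

/-- The class sum at a real point `x > 1` is the real series computed in `ℝ≥0∞`. [folklore] -/
theorem classSum_ofReal (C : ClassGroup (𝓞 K)) {x : ℝ} (hx : 1 < x) :
    (∑' I : {I : (Ideal (𝓞 K))⁰ // ClassGroup.mk0 I = C},
        ((Ideal.absNorm (I.1 : Ideal (𝓞 K)) : ℕ) : ℂ) ^ (-(x : ℂ))) =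
      (((∑' I : {I : (Ideal (𝓞 K))⁰ // ClassGroup.mk0 I = C},
        ENNReal.ofReal ((Ideal.absNorm (I.1 : Ideal (𝓞 K)) : ℝ) ^ (-x))).toReal : ℝ) : ℂ) := by
  have hterm : ∀ I : {I : (Ideal (𝓞 K))⁰ // ClassGroup.mk0 I = C},
      ((Ideal.absNorm (I.1 : Ideal (𝓞 K)) : ℕ) : ℂ) ^ (-(x : ℂ)) =
        (((Ideal.absNorm (I.1 : Ideal (𝓞 K)) : ℝ) ^ (-x) : ℝ) : ℂ) := by
    intro I
    rw [Complex.ofReal_cpow (Nat.cast_nonneg _), Complex.ofReal_natCast, Complex.ofReal_neg]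
  simp_rw [hterm]
  rw [← Complex.ofReal_tsum]
  congr 1
  have hsum : Summable (fun (I : {I : (Ideal (𝓞 K))⁰ // ClassGroup.mk0 I = C}) ↦
      ((Ideal.absNorm I.1.1 : ℝ) ^ (-x))) := by
    have h := summable_norm_classSum_term C (s := (x : ℂ)) (by simpa using hx)
    refine h.congr fun I ↦ ?_
    rw [Complex.norm_natCast_cpow_of_pos (Ideal.absNorm_pos_of_nonZeroDivisors I.1), Complex.neg_re,
      Complex.ofReal_re]
  rw [ENNReal.tsum_toReal_eq (fun _ ↦ ENNReal.ofReal_ne_top)]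
  refine tsum_congr fun I ↦ ?_
  rw [ENNReal.toReal_ofReal (Real.rpow_nonneg (Nat.cast_nonneg _) _)]

/-- The Gamma factor `A(s') = Cst · ∏_w (π e_w)^{-e_w s'} Γ(e_w s')` at a real point. [folklore] -/
theorem gammaFactorC_ofReal (σ : ℝ) :
    (∏ w : InfinitePlace K, (((1 / (Real.pi * mult w) : ℝ)) : ℂ) ^ ((mult w : ℂ) * (σ : ℂ)) *
        Complex.Gamma ((mult w : ℂ) * (σ : ℂ))) =
      ((∏ w : InfinitePlace K, (1 / (Real.pi * mult w)) ^ ((mult w : ℝ) * σ) * Real.Gamma ((mult w : ℝ) * σ) : ℝ) : ℂ) := by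
  rw [Complex.ofReal_prod]
  refine Finset.prod_congr rfl fun w _ ↦ ?_
  have h0 : (0 : ℝ) ≤ 1 / (Real.pi * mult w) := by
    have : (0 : ℝ) < mult w := Nat.cast_pos.mpr mult_pos
    positivity
  rw [Complex.ofReal_mul, Complex.ofReal_cpow h0, ← Complex.Gamma_ofReal]
  push_cast
  ring_nf

/-- The Gamma factor is holomorphic on `Re(s') > 0`. [folklore] -/
theorem differentiableAt_gammaFactorC {s' : ℂ} (hs' : 0 < s'.re) :
    DifferentiableAt ℂ (fun z : ℂ ↦ ∏ w : InfinitePlace K, (((1 / (Real.pi * mult w) : ℝ)) : ℂ) ^ ((mult w : ℂ) * z) *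
        Complex.Gamma ((mult w : ℂ) * z)) s' := by
  set F : InfinitePlace K → ℂ → ℂ := fun w z ↦ (((1 / (Real.pi * mult w) : ℝ)) : ℂ) ^ ((mult w : ℂ) * z) *
    Complex.Gamma ((mult w : ℂ) * z) with hF
  have hd : ∀ w ∈ (Finset.univ : Finset (InfinitePlace K)), DifferentiableAt ℂ (F w) s' := by
    intro w _
    have hm : (0 : ℝ) < mult w := Nat.cast_pos.mpr mult_pos
    have hc : (1 / (Real.pi * mult w) : ℝ) ≠ 0 := by positivity
    refine DifferentiableAt.mul ?_ ?_
    · refine DifferentiableAt.const_cpow (differentiableAt_id.const_mul _) (Or.inl ?_)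
      exact_mod_cast hc
    · refine (Complex.differentiableAt_Gamma _ fun m h ↦ ?_).comp s' (differentiableAt_id.const_mul _)
      have h1 : ((mult w : ℂ) * s').re = (mult w : ℝ) * s'.re := by simp [Complex.mul_re]
      have h3 := congr_arg Complex.re h
      rw [h1] at h3
      simp only [Complex.neg_re, Complex.natCast_re] at h3
      have : 0 < (mult w : ℝ) * s'.re := mul_pos hm hs'
      linarith [(Nat.cast_nonneg m : (0:ℝ) ≤ m)]
  have key := DifferentiableAt.finsetProd hd
  have heq : (∏ w ∈ (Finset.univ : Finset (InfinitePlace K)), F w) = fun z ↦ ∏ w, F w z := by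
    funext z
    exact Finset.prod_apply z Finset.univ F
  rw [heq] at key
  exact key


/-- **`Λ_J(s/2) = A(s/2) · w · 𝔑(J)^{-s} · ∑_{I ∈ C} 𝔑(I)^{-s}` for `Re(s) > 1`** — Neukirch VII (5.9)
(`Z(𝔎, s) = L(f, s/2)`) with (5.4), extended from real `s` (`heckePair_Λ_real_eq`) to the half-plane by
the identity theorem (both sides are holomorphic on `Re(s) > 1`). [cite: NeukirchANT1999, Ch. VII (5.9)] -/
theorem heckePair_Λ_eq_classSum (hinv : thetaIdeal_inv K) (C : ClassGroup (𝓞 K)) (J : (Ideal (𝓞 K))⁰)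
    (hJ : ClassGroup.mk0 J = C⁻¹) {s : ℂ} (hs : 1 < s.re) :
    (heckePair K hinv _ (coeIdeal_ne_zero_of_mem_nonZeroDivisors J)).Λ (s / 2) =
      (((2 ^ rank K)⁻¹ * Module.finrank ℚ K * (2⁻¹ ^ nrComplexPlaces K * Module.finrank ℚ K * regulator K)⁻¹ : ℝ) : ℂ) *
        (∏ w : InfinitePlace K, (((1 / (Real.pi * mult w) : ℝ)) : ℂ) ^ ((mult w : ℂ) * (s / 2)) *
          Complex.Gamma ((mult w : ℂ) * (s / 2))) *
        (torsionOrder K : ℂ) * (Ideal.absNorm (J : Ideal (𝓞 K)) : ℂ) ^ (-s) *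
        (∑' I : {I : (Ideal (𝓞 K))⁰ // ClassGroup.mk0 I = C},
          ((Ideal.absNorm I.1.1 : ℕ) : ℂ) ^ (-s)) := by
  set P := heckePair K hinv _ (coeIdeal_ne_zero_of_mem_nonZeroDivisors J) with hP
  obtain ⟨A, hA⟩ : ∃ A : ℂ → ℂ, A = fun z ↦ ∏ w : InfinitePlace K,
      (((1 / (Real.pi * mult w) : ℝ)) : ℂ) ^ ((mult w : ℂ) * z) * Complex.Gamma ((mult w : ℂ) * z) := ⟨_, rfl⟩
  obtain ⟨T, hT⟩ : ∃ T : ℂ → ℂ, T = fun z ↦ ∑' I : {I : (Ideal (𝓞 K))⁰ // ClassGroup.mk0 I = C},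
      ((Ideal.absNorm I.1.1 : ℕ) : ℂ) ^ (-z) := ⟨_, rfl⟩
  obtain ⟨G₁, hG₁⟩ : ∃ G₁ : ℂ → ℂ, G₁ = fun z ↦ P.Λ (z / 2) := ⟨_, rfl⟩
  obtain ⟨G₂, hG₂⟩ : ∃ G₂ : ℂ → ℂ, G₂ = fun z ↦
      (((2 ^ rank K)⁻¹ * Module.finrank ℚ K * (2⁻¹ ^ nrComplexPlaces K * Module.finrank ℚ K * regulator K)⁻¹ : ℝ) : ℂ) *
        A (z / 2) * (torsionOrder K : ℂ) * (Ideal.absNorm (J : Ideal (𝓞 K)) : ℂ) ^ (-z) * T z := ⟨_, rfl⟩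
  set U : Set ℂ := {z | 1 < z.re} with hU
  have hgoal : G₁ s = G₂ s → _ := fun h ↦ by
    rw [hG₁, hG₂, hA, hT] at h
    exact h
  apply hgoal
  suffices h : Set.EqOn G₁ G₂ U from h hs
  have hUo : IsOpen U := isOpen_lt continuous_const Complex.continuous_re
  have hUc : IsPreconnected U := (convex_halfSpace_re_gt 1).isPreconnected
  have h2 : (2 : ℂ) ∈ U := by simp [hU]
  -- analyticity of `G₁`
  have hG₁a : AnalyticOnNhd ℂ G₁ U := by
    rw [hG₁]
    refine DifferentiableOn.analyticOnNhd (fun z hz ↦ ?_) hUo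
    have hz2 : (1 / 2 : ℝ) < (z / 2).re := by
      simp only [hU, Set.mem_setOf_eq] at hz
      simp only [Complex.div_ofNat_re]
      linarith
    refine DifferentiableAt.differentiableWithinAt ?_
    refine (P.differentiableAt_Λ (Or.inl ?_) (Or.inl ?_)).comp z (differentiableAt_id.div_const 2)
    · intro h; rw [h, Complex.zero_re] at hz2; linarith
    · intro h
      rw [h] at hz2
      simp [hP, heckePair] at hz2
  -- analyticity of `G₂`
  have hG₂a : AnalyticOnNhd ℂ G₂ U := by
    rw [hG₂]
    refine DifferentiableOn.analyticOnNhd (fun z hz ↦ ?_) hUo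
    have hz1 : 1 < z.re := hz
    have hz' : 0 < (z / 2).re := by simp only [Complex.div_ofNat_re]; linarith
    have hA1 : DifferentiableAt ℂ A (z / 2) := by rw [hA]; exact differentiableAt_gammaFactorC hz'
    have hA' : DifferentiableAt ℂ (fun z ↦ A (z / 2)) z := hA1.comp z (differentiableAt_id.div_const 2)
    have hN : DifferentiableAt ℂ (fun z ↦ (Ideal.absNorm (J : Ideal (𝓞 K)) : ℂ) ^ (-z)) z := by
      refine DifferentiableAt.const_cpow differentiableAt_id.neg (Or.inl ?_)
      exact_mod_cast (Ideal.absNorm_pos_of_nonZeroDivisors J).ne'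
    have hTd : DifferentiableWithinAt ℂ T U z := by rw [hT]; exact differentiableOn_classSum (K := K) C z hz
    exact ((((differentiableAt_const _).mul hA').mul (differentiableAt_const _)).mul hN).differentiableWithinAt.mul hTd
  -- equality at real points `x > 1`
  have hreal : ∀ x : ℝ, 1 < x → G₁ x = G₂ x := by
    intro x hx
    have hx2 : 1 / 2 < x / 2 := by linarith
    obtain ⟨-, hΛ⟩ := heckePair_Λ_real_eq hinv C J hJ hx2
    have h2x : 2 * (x / 2) = x := by ring
    rw [h2x] at hΛ
    have hcast : ((x : ℂ) / 2) = ((x / 2 : ℝ) : ℂ) := by push_cast; ring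
    have hTx : T x = (((∑' I : {I : (Ideal (𝓞 K))⁰ // ClassGroup.mk0 I = C},
        ENNReal.ofReal ((Ideal.absNorm I.1.1 : ℝ) ^ (-x))).toReal : ℝ) : ℂ) := by
      rw [hT]; exact classSum_ofReal C hx
    have hAx : A ((x / 2 : ℝ) : ℂ) = ((∏ w : InfinitePlace K, (1 / (Real.pi * mult w)) ^ ((mult w : ℝ) * (x / 2)) *
        Real.Gamma ((mult w : ℝ) * (x / 2)) : ℝ) : ℂ) := by
      rw [hA]; exact gammaFactorC_ofReal (x / 2)
    have hNx : (Ideal.absNorm (J : Ideal (𝓞 K)) : ℂ) ^ (-(x : ℂ)) =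
        (((Ideal.absNorm (J : Ideal (𝓞 K)) : ℝ) ^ (-x) : ℝ) : ℂ) := by
      rw [Complex.ofReal_cpow (Nat.cast_nonneg _), Complex.ofReal_natCast, Complex.ofReal_neg]
    rw [hG₁, hG₂]
    simp only []
    rw [hcast, hΛ, hTx, hAx, hNx]
    push_cast
    ring
  -- `G₁ = G₂` frequently near `2`
  have hfreq : ∃ᶠ z in nhdsWithin (2 : ℂ) {(2 : ℂ)}ᶜ, G₁ z = G₂ z := by
    set u : ℕ → ℝ := fun n ↦ 2 + 1 / ((n : ℝ) + 1) with hu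
    have hu1 : Filter.Tendsto u Filter.atTop (nhds 2) := by
      have := tendsto_one_div_add_atTop_nhds_zero_nat.const_add (2 : ℝ)
      rwa [add_zero] at this
    have hu2 : Filter.Tendsto (fun n ↦ ((u n : ℝ) : ℂ)) Filter.atTop (nhds ((2 : ℝ) : ℂ)) :=
      (Complex.continuous_ofReal.tendsto _).comp hu1
    have h2c : ((2 : ℝ) : ℂ) = 2 := by norm_num
    rw [h2c] at hu2
    have ht : Filter.Tendsto (fun n ↦ ((u n : ℝ) : ℂ)) Filter.atTop (nhdsWithin (2 : ℂ) {(2 : ℂ)}ᶜ) := by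
      refine tendsto_nhdsWithin_of_tendsto_nhds_of_eventually_within _ hu2
        (Filter.Eventually.of_forall fun n ↦ ?_)
      simp only [Set.mem_compl_iff, Set.mem_singleton_iff]
      intro h
      rw [← h2c] at h
      have h' : u n = 2 := Complex.ofReal_injective h
      have : (0 : ℝ) < 1 / ((n : ℝ) + 1) := by positivity
      simp only [hu] at h'
      linarith
    refine ht.frequently (Filter.Eventually.frequently (Filter.Eventually.of_forall fun n ↦ ?_))
    have hun : 1 < u n := by
      have : (0 : ℝ) < 1 / ((n : ℝ) + 1) := by positivity
      simp only [hu]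
      linarith
    exact hreal (u n) hun
  exact hG₁a.eqOn_of_preconnected_of_frequently_eq hG₂a hUc h2 hfreq


/-! ## (vi) The continued class partial zeta function (Neukirch VII (5.9), (5.10)) -/

/-- The inverse Gamma factor `A(s')⁻¹ = ∏_w (π e_w)^{e_w s'} Γ(e_w s')⁻¹` is entire (`1/Γ` is entire,
Mathlib `Complex.differentiable_one_div_Gamma`). [folklore] -/
theorem differentiable_inv_gammaFactorC :
    Differentiable ℂ (fun z : ℂ ↦ (∏ w : InfinitePlace K, (((1 / (Real.pi * mult w) : ℝ)) : ℂ) ^ ((mult w : ℂ) * z) *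
        Complex.Gamma ((mult w : ℂ) * z))⁻¹) := by
  set F : InfinitePlace K → ℂ → ℂ := fun w z ↦
    (((1 / (Real.pi * mult w) : ℝ)) : ℂ) ^ (-((mult w : ℂ) * z)) * (Complex.Gamma ((mult w : ℂ) * z))⁻¹ with hF
  have heq : (fun z : ℂ ↦ (∏ w : InfinitePlace K, (((1 / (Real.pi * mult w) : ℝ)) : ℂ) ^ ((mult w : ℂ) * z) *
        Complex.Gamma ((mult w : ℂ) * z))⁻¹) = fun z ↦ ∏ w ∈ (Finset.univ : Finset (InfinitePlace K)), F w z := by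
    funext z
    rw [← Finset.prod_inv_distrib]
    refine Finset.prod_congr rfl fun w _ ↦ ?_
    simp only [hF, mul_inv, Complex.cpow_neg]
  rw [heq]
  have hd : ∀ w ∈ (Finset.univ : Finset (InfinitePlace K)), Differentiable ℂ (F w) := by
    intro w _
    have hc : (1 / (Real.pi * mult w) : ℝ) ≠ 0 := by
      have : (0 : ℝ) < mult w := Nat.cast_pos.mpr mult_pos
      positivity
    refine Differentiable.mul ?_ ?_
    · refine Differentiable.const_cpow (differentiable_id.const_mul _).neg (Or.inl ?_)
      exact_mod_cast hc
    · exact Complex.differentiable_one_div_Gamma.comp (differentiable_id.const_mul _)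
  have key := Differentiable.finsetProd hd
  have heq2 : (∏ w ∈ (Finset.univ : Finset (InfinitePlace K)), F w) = fun z ↦ ∏ w ∈ Finset.univ, F w z := by
    funext z; exact Finset.prod_apply z Finset.univ F
  rw [heq2] at key
  exact key

/-- `Γ(e s')⁻¹ = e s' Γ(e s' + 1)⁻¹` for all `s'` (with Mathlib's `Γ(0) = 0`). [folklore] -/
theorem inv_Gamma_eq_mul_inv_Gamma_add_one (e s' : ℂ) :
    (Complex.Gamma (e * s'))⁻¹ = e * s' * (Complex.Gamma (e * s' + 1))⁻¹ := by
  by_cases h : e * s' = 0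
  · rw [h, Complex.Gamma_zero, inv_zero, zero_mul]
  · rw [Complex.Gamma_add_one _ h, mul_inv, ← mul_assoc, mul_inv_cancel₀ h, one_mul]

/-- **The continued class partial zeta function** (Neukirch VII (5.9): `Z(𝔎, s)` continues to
`ℂ ∖ {0, 1}`; (5.11) (i): dividing by the Euler factor at infinity removes the pole at `s = 0`). For an
integral ideal `J` with `mk0 J = C⁻¹` there is `D` holomorphic on `ℂ ∖ {1}` with
`D(s) = ∑_{I ∈ C} 𝔑(I)^{-s}` for `Re(s) > 1`; conditional on the theta transformation formula
`thetaIdeal_inv`. [cite: NeukirchANT1999, Ch. VII (5.9)] -/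
theorem exists_classSum_continuation (hinv : thetaIdeal_inv K) (C : ClassGroup (𝓞 K)) :
    ∃ D : ℂ → ℂ, DifferentiableOn ℂ D {1}ᶜ ∧ ∀ s : ℂ, 1 < s.re →
      D s = ∑' I : {I : (Ideal (𝓞 K))⁰ // ClassGroup.mk0 I = C}, ((Ideal.absNorm I.1.1 : ℕ) : ℂ) ^ (-s) := by
  classical
  -- a representative `J` of `C⁻¹`
  obtain ⟨J, hJ⟩ := ClassGroup.mk0_surjective C⁻¹
  set P := heckePair K hinv _ (coeIdeal_ne_zero_of_mem_nonZeroDivisors J) with hP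
  -- the Gamma factor and its inverse
  obtain ⟨A, hA⟩ : ∃ A : ℂ → ℂ, A = fun z ↦ ∏ w : InfinitePlace K,
      (((1 / (Real.pi * mult w) : ℝ)) : ℂ) ^ ((mult w : ℂ) * z) * Complex.Gamma ((mult w : ℂ) * z) := ⟨_, rfl⟩
  have hAinv : Differentiable ℂ (fun z ↦ (A z)⁻¹) := by rw [hA]; exact differentiable_inv_gammaFactorC
  -- a distinguished place and the modified inverse factor `E₀(s') = A(s')⁻¹ / s'` (entire)
  obtain ⟨w₁⟩ : Nonempty (InfinitePlace K) := inferInstance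
  obtain ⟨E₀, hE₀⟩ : ∃ E₀ : ℂ → ℂ, E₀ = fun z ↦
      (∏ w ∈ Finset.univ.erase w₁, ((((1 / (Real.pi * mult w) : ℝ)) : ℂ) ^ (-((mult w : ℂ) * z)) *
        (Complex.Gamma ((mult w : ℂ) * z))⁻¹)) *
      ((((1 / (Real.pi * mult w₁) : ℝ)) : ℂ) ^ (-((mult w₁ : ℂ) * z)) * (mult w₁ : ℂ) *
        (Complex.Gamma ((mult w₁ : ℂ) * z + 1))⁻¹) := ⟨_, rfl⟩
  have hc : ∀ w : InfinitePlace K, (((1 / (Real.pi * mult w) : ℝ)) : ℂ) ≠ 0 := fun w ↦ by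
    have : (0 : ℝ) < mult w := Nat.cast_pos.mpr mult_pos
    exact_mod_cast (by positivity : (1 / (Real.pi * mult w) : ℝ) ≠ 0)
  have hE₀d : Differentiable ℂ E₀ := by
    rw [hE₀]
    refine Differentiable.mul ?_ ?_
    · have hd : ∀ w ∈ Finset.univ.erase w₁, Differentiable ℂ (fun z : ℂ ↦
          (((1 / (Real.pi * mult w) : ℝ)) : ℂ) ^ (-((mult w : ℂ) * z)) * (Complex.Gamma ((mult w : ℂ) * z))⁻¹) := by
        intro w _
        refine Differentiable.mul ?_ ?_
        · exact Differentiable.const_cpow (differentiable_id.const_mul _).neg (Or.inl (hc w))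
        · exact Complex.differentiable_one_div_Gamma.comp (differentiable_id.const_mul _)
      have key := Differentiable.finsetProd hd
      have heq2 : (∏ w ∈ Finset.univ.erase w₁, fun z : ℂ ↦
          (((1 / (Real.pi * mult w) : ℝ)) : ℂ) ^ (-((mult w : ℂ) * z)) * (Complex.Gamma ((mult w : ℂ) * z))⁻¹) =
          fun z ↦ ∏ w ∈ Finset.univ.erase w₁,
            ((((1 / (Real.pi * mult w) : ℝ)) : ℂ) ^ (-((mult w : ℂ) * z)) * (Complex.Gamma ((mult w : ℂ) * z))⁻¹) := by
        funext z; exact Finset.prod_apply z _ _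
      rw [heq2] at key
      exact key
    · refine Differentiable.mul (Differentiable.mul ?_ (differentiable_const _)) ?_
      · exact Differentiable.const_cpow (differentiable_id.const_mul _).neg (Or.inl (hc w₁))
      · exact Complex.differentiable_one_div_Gamma.comp ((differentiable_id.const_mul _).add_const _)
  have hAinv_eq : ∀ z : ℂ, (A z)⁻¹ = ∏ w : InfinitePlace K,
      ((((1 / (Real.pi * mult w) : ℝ)) : ℂ) ^ (-((mult w : ℂ) * z)) * (Complex.Gamma ((mult w : ℂ) * z))⁻¹) := by
    intro z
    rw [hA]
    simp only []
    rw [← Finset.prod_inv_distrib]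
    refine Finset.prod_congr rfl fun w _ ↦ ?_
    rw [mul_inv, Complex.cpow_neg]
  have hE₀eq : ∀ z : ℂ, z ≠ 0 → E₀ z = (A z)⁻¹ / z := by
    intro z hz
    rw [hAinv_eq, ← Finset.prod_erase_mul _ _ (Finset.mem_univ w₁), hE₀]
    simp only []
    rw [mul_div_assoc]
    congr 1
    rw [inv_Gamma_eq_mul_inv_Gamma_add_one (mult w₁ : ℂ) z]
    field_simp
  -- the continuation
  set Cst : ℝ := (2 ^ rank K)⁻¹ * Module.finrank ℚ K *
    (2⁻¹ ^ nrComplexPlaces K * Module.finrank ℚ K * regulator K)⁻¹ with hCst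
  have hCst0 : Cst ≠ 0 := by
    have := regulator_pos K
    have : (0 : ℝ) < Module.finrank ℚ K := Nat.cast_pos.mpr Module.finrank_pos
    positivity
  have hw0 : (torsionOrder K : ℂ) ≠ 0 := by exact_mod_cast torsionOrder_ne_zero K
  have hNJ0 : (Ideal.absNorm (J : Ideal (𝓞 K)) : ℂ) ≠ 0 := by
    exact_mod_cast (Ideal.absNorm_pos_of_nonZeroDivisors J).ne'
  obtain ⟨Bi, hBi⟩ : ∃ Bi : ℂ → ℂ, Bi = fun s ↦ ((Cst : ℂ))⁻¹ * ((torsionOrder K : ℂ))⁻¹ *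
      (Ideal.absNorm (J : Ideal (𝓞 K)) : ℂ) ^ s * (A (s / 2))⁻¹ := ⟨_, rfl⟩
  obtain ⟨B0, hB0⟩ : ∃ B0 : ℂ → ℂ, B0 = fun s ↦ ((Cst : ℂ))⁻¹ * ((torsionOrder K : ℂ))⁻¹ *
      (Ideal.absNorm (J : Ideal (𝓞 K)) : ℂ) ^ s * E₀ (s / 2) := ⟨_, rfl⟩
  have hBid : Differentiable ℂ Bi := by
    rw [hBi]
    refine Differentiable.mul (Differentiable.mul (differentiable_const _) ?_) ?_
    · exact Differentiable.const_cpow differentiable_id (Or.inl hNJ0)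
    · exact hAinv.comp (differentiable_id.div_const 2)
  have hB0d : Differentiable ℂ B0 := by
    rw [hB0]
    refine Differentiable.mul (Differentiable.mul (differentiable_const _) ?_) ?_
    · exact Differentiable.const_cpow differentiable_id (Or.inl hNJ0)
    · exact hE₀d.comp (differentiable_id.div_const 2)
  refine ⟨fun s ↦ Bi s * (P.Λ₀ (s / 2) - P.ε / (((1 / 2 : ℝ) : ℂ) - s / 2)) - B0 s, ?_, ?_⟩
  · -- holomorphy on `ℂ ∖ {1}`
    intro s hs
    have hs1 : s ≠ 1 := hs
    refine DifferentiableAt.differentiableWithinAt ?_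
    refine DifferentiableAt.sub (DifferentiableAt.mul (hBid s) (DifferentiableAt.sub ?_ ?_)) (hB0d s)
    · exact (P.differentiable_Λ₀.comp (differentiable_id.div_const 2)) s
    · refine DifferentiableAt.div (differentiableAt_const _) ?_ ?_
      · exact (differentiableAt_const _).sub (differentiableAt_id.div_const 2)
      · intro h
        apply hs1
        have : s / 2 = ((1 / 2 : ℝ) : ℂ) := (sub_eq_zero.mp h).symm
        have := congr_arg (fun z : ℂ ↦ 2 * z) this
        push_cast at this
        linear_combination this
  · -- the value for `Re(s) > 1`
    intro s hs
    have hs0 : s ≠ 0 := fun h ↦ by rw [h, Complex.zero_re] at hs; linarith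
    have hs2 : s / 2 ≠ 0 := div_ne_zero hs0 two_ne_zero
    have hΛ := heckePair_Λ_eq_classSum hinv C J hJ hs
    have hAs : A (s / 2) = ∏ w : InfinitePlace K, (((1 / (Real.pi * mult w) : ℝ)) : ℂ) ^ ((mult w : ℂ) * (s / 2)) *
        Complex.Gamma ((mult w : ℂ) * (s / 2)) := by rw [hA]
    rw [← hP, ← hAs] at hΛ
    -- `A(s/2) ≠ 0`
    have hA0 : A (s / 2) ≠ 0 := by
      rw [hAs]
      refine Finset.prod_ne_zero_iff.mpr fun w _ ↦ mul_ne_zero ?_ ?_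
      · exact fun h ↦ (Complex.cpow_eq_zero_iff _ _ |>.mp h).1 |> hc w
      · refine Complex.Gamma_ne_zero_of_re_pos ?_
        have : (0 : ℝ) < mult w := Nat.cast_pos.mpr mult_pos
        simp only [Complex.mul_re, Complex.natCast_re, Complex.natCast_im, zero_mul, sub_zero,
          Complex.div_ofNat_re]
        positivity
    have hNs0 : (Ideal.absNorm (J : Ideal (𝓞 K)) : ℂ) ^ s ≠ 0 :=
      fun h ↦ hNJ0 (Complex.cpow_eq_zero_iff _ _ |>.mp h).1
    have hCst0' : (Cst : ℂ) ≠ 0 := Complex.ofReal_ne_zero.mpr hCst0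
    -- `B0 s = Bi s / (s/2)` and the definition of `Λ`
    have hB0s : B0 s = Bi s * (1 / (s / 2)) := by
      rw [hB0, hBi]
      simp only []
      rw [hE₀eq _ hs2]
      ring
    have hΛdef : P.Λ (s / 2) = P.Λ₀ (s / 2) - (1 / (s / 2)) • P.f₀ - (P.ε / ((P.k : ℂ) - s / 2)) • P.g₀ := rfl
    have hf0 : P.f₀ = 1 := rfl
    have hg0 : P.g₀ = 1 := rfl
    have hk : (P.k : ℂ) = ((1 / 2 : ℝ) : ℂ) := rfl
    rw [hf0, hg0, hk, smul_eq_mul, smul_eq_mul, mul_one, mul_one] at hΛdef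
    simp only []
    rw [hB0s]
    calc Bi s * (P.Λ₀ (s / 2) - P.ε / (((1 / 2 : ℝ) : ℂ) - s / 2)) - Bi s * (1 / (s / 2))
        = Bi s * P.Λ (s / 2) := by rw [hΛdef]; ring
      _ = ∑' I : {I : (Ideal (𝓞 K))⁰ // ClassGroup.mk0 I = C}, ((Ideal.absNorm I.1.1 : ℕ) : ℂ) ^ (-s) := by
          rw [hΛ, hBi]
          simp only []
          rw [Complex.cpow_neg]
          field_simp
          rw [hCst]
          push_cast
          field_simp


/-! ## (vii) Hecke's continuation of `ζ_K` (Neukirch VII (5.10), (5.11) (i)), from `thetaIdeal_inv` -/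

/-- The Dirichlet series of `ζ_K` split along the ideal classes: for `Re(s) > 1`,
`ζ_K(s) = ∑_{𝔎 ∈ Cl_K} ∑_{𝔟 ∈ 𝔎} 𝔑(𝔟)^{-s}` (Neukirch VII §5, after (5.2):
`ζ_K(s) = ∑_𝔎 ζ(𝔎, s)` with the partial zeta functions `ζ(𝔎, s)`). [cite: NeukirchANT1999, Ch. VII §5] -/
theorem dedekindZeta_eq_sum_classSum {s : ℂ} (hs : 1 < s.re) :
    dedekindZeta K s = ∑ C : ClassGroup (𝓞 K), ∑' I : {I : (Ideal (𝓞 K))⁰ // ClassGroup.mk0 I = C},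
      ((Ideal.absNorm I.1.1 : ℕ) : ℂ) ^ (-s) := by
  classical
  have hs0 : -s ≠ 0 := neg_ne_zero.mpr fun h ↦ by rw [h, Complex.zero_re] at hs; linarith
  have h1 := Literature.NumberTheory.LFunctions.hasSum_absNorm_cpow K hs
  -- restrict to nonzero ideals
  have h2 : HasSum (fun I : (Ideal (𝓞 K))⁰ ↦ ((Ideal.absNorm (I : Ideal (𝓞 K)) : ℕ) : ℂ) ^ (-s))
      (dedekindZeta K s) := by
    refine (Function.Injective.hasSum_iff Subtype.val_injective fun I hI ↦ ?_).mpr h1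
    have hI0 : I = 0 := by
      by_contra h
      exact hI ⟨⟨I, mem_nonZeroDivisors_iff_ne_zero.mpr h⟩, rfl⟩
    rw [hI0, Submodule.zero_eq_bot, Ideal.absNorm_bot, Nat.cast_zero, Complex.zero_cpow hs0]
  have h3 := h2.tsum_fiberwise (fun I : (Ideal (𝓞 K))⁰ ↦ ClassGroup.mk0 I)
  rw [← h3.tsum_eq, tsum_fintype]
  rfl

/-- **Hecke's theorem from the theta transformation formula** (Neukirch VII (5.10) Corollary and
(5.11) (i): `ζ_K(s) = ∑_𝔎 ζ(𝔎, s)` has an analytic continuation to `ℂ ∖ {1}`), here derived from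
the continued class partial zeta functions `exists_classSum_continuation`, hence conditional only on
the theta transformation formula `thetaIdeal_inv` (Neukirch VII (3.6) & (5.7)).
[cite: NeukirchANT1999, Ch. VII (5.11) (i)] -/
theorem exists_isDedekindZetaContinuation_of_thetaIdeal_inv (hinv : thetaIdeal_inv K) :
    exists_isDedekindZetaContinuation K := by
  classical
  choose D hD hDeq using fun C : ClassGroup (𝓞 K) ↦ exists_classSum_continuation hinv C
  refine ⟨fun s ↦ ∑ C : ClassGroup (𝓞 K), D C s, ?_, ?_⟩
  · exact DifferentiableOn.fun_sum fun C _ ↦ hD C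
  · intro s hs
    have hs' : 1 < s.re := hs
    rw [dedekindZeta_eq_sum_classSum hs']
    exact Finset.sum_congr rfl fun C _ ↦ hDeq C s hs'

end Literature.NumberTheory.LFunctions.NumberField
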